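import Mathlib.Analysis.SpecialFunctions.Pow.Real
import Mathlib.Analysis.SpecialFunctions.Sqrt
import Literature.Analysis.FunctionSpaces.TorusFourierModes
import Literature.Analysis.FluidPDE.TorusClassicalLerayHopfProofs
import Literature.Analysis.FluidPDE.TaoEnstrophyContinuity
import Literature.Barriers.AnomalousDissipation.ClassicalEulerLimit
import HarnessLib

/-!
# Proofs: no anomalous dissipation before the first Euler singularity (Bruè–De Lellis 2023)

Sibling proof file of `ClassicalEulerLimit.lean` (D-0014); no new definitions. Both named facts
of that file are discharged:

* `BrueDeLellis2023_lemma7_convergence_holds` — convergence of classical Navier–Stokes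
  solutions to a classical forced Euler solution in `C([0,T]; L²(T³))`;
* `BrueDeLellis2023_noAnomaly_beforeEulerSingularity_holds` — the dissipation
  `ν_j ∫₀ᵀ ‖∇u_j‖² dt` tends to `0` along such a sequence (the barrier fact);
* `BrueDeLellis2023_noAnomaly_beforeEulerSingularityNarrow_holds` — the narrowed companion of
  the D-0021 barrier audit (classical solvability of smooth-forced Euler on `T³` over `[0,1]`
  excludes the hub-form Question 2.1), with the explicit reductions
  `BrueDeLellis2023_question21_imp_forcedEuler_breakdown` /
  `BrueDeLellis2023_question22_imp_forcedEuler_breakdown`: a positive answer to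
  `Literature.Analysis.FluidPDE.BrueDeLellisQuestion21` (resp. `…22`) exhibits a smooth
  divergence-free datum and a smooth (resp. smooth time-independent) force whose forced Euler
  problem has no classical solution on `[0,1]`.

Source: E. Bruè, C. De Lellis, *Anomalous dissipation for the forced 3D Navier–Stokes
equations*, Comm. Math. Phys. 400 (2023) = arXiv:2207.06301, §1 (p. 3: "It is then relatively
simple to show that `u^ν` converges strongly in `C([0,T]; L²(T³))` … as long as on the interval
`[0,T]` the solution stays Lipschitz. From this strong convergence, it is then elementary to
infer that [anomalous dissipation] cannot hold") and the Appendix, §9 of the arXiv version,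
**Lemma 7** with its proof and the sentence following it.

## The argument (as printed, and where the formalisation deviates)

Fix a classical forced Euler solution `(u, p, f)` and a classical Navier–Stokes solution
`(u^ν, p^ν, f^ν)` on `[0, T] × T^d`, and put `w = u^ν − u`, `y(t) = ∫ ‖w(t)‖²`.

1. *Lemma 7 (proof).* Subtract the equations and pair with the divergence-free `w`
   (`Torus.IsClassicalNSSolutionOn.integral_inner_timeDerivWithin_sub_le`): the pressures drop
   out (`Torus.integral_inner_gradient_eq_zero_of_isDivFree`); the convective terms are
   `(u^ν·∇)u^ν − (u·∇)u = (u^ν·∇)w + (w·∇)u` with `∫ ⟪(u^ν·∇)w, w⟫ = 0`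
   (`Torus.integral_inner_convect_eq_neg`) and `|∫ ⟪(w·∇)u, w⟫| ≤ ‖∇u‖_∞ ∫ ‖w‖²` ("a very
   well-known fact which can be proved by elementary integration by parts"); the viscous term is
   `ν∫ ⟪w, Δu^ν⟫ = −ν‖∇w‖² + ν∫ ⟪w, Δu⟫ ≤ ν ‖Δu‖_∞ ∫ ‖w‖` (the paper bounds it by
   `(ν/4)‖∇u‖²` instead; either bound is `O(ν)`); the force term is bounded by Cauchy–Schwarz,
   `|∫ ⟪f^ν − f, w⟫| ≤ ‖f^ν − f‖_{L²} ‖w‖_{L²}`.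
   *Deviation.* The printed inequality (e:Gronwall) applies Young to the last product,
   `≤ ½∫|f − f^ν|² + ½∫|w|²`, whose time integral is the `L²(0,T;L²)` distance of the forces,
   while the printed (and vendored) hypothesis is convergence in `L¹(0,T;L²)`. We therefore keep
   the product, use `‖w‖_{L²}, ∫‖w‖ ≤ (1 + y)/2`, and obtain
   `y' ≤ (2L + νC_Δ + g) y + (νC_Δ + g)` with `g(t) = ‖f^ν(t) − f(t)‖_{L²}`,
   `L ≥ sup ∑ᵢ‖∂ᵢu‖`, `C_Δ ≥ sup ‖Δu‖`; under the
   bootstrap hypothesis `y ≤ 1` (and `ν ≤ 1`) this is `y' ≤ κ y + (2g + νC_Δ)` with a constant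
   `κ`, and the continuity method with Grönwall's inequality (`NS.bootstrap_gronwall`) gives
   `y(t) ≤ e^{κT}(y(0) + 2∫₀ᵀ g + νC_ΔT)` as soon as the right-hand side is `< 1`
   (`Torus.IsClassicalNSSolutionOn.integral_norm_sub_sq_le_of_lt_one`). The statements proved
   are exactly the printed ones; only this intermediate inequality differs.
2. *Uniform convergence* ("then `u^ν → u` in `C([0,T]; L²)`"): along `ν_j ↓ 0`,
   `∫₀ᵀ ‖f_j − f‖_{L²} → 0`, `‖u_j(0) − u(0)‖_{L²} → 0` the Grönwall bounds `M_j` tend to `0`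
   (`Torus.IsClassicalNSSolutionOn.exists_uniform_integral_norm_sub_sq_le`,
   `Torus.IsClassicalNSSolutionOn.tendsto_iSup_eLpNorm_sub`).
3. *No anomalous dissipation* ("elementary to infer"): by the energy equalities
   (`Torus.IsClassicalNSSolutionOn.energy_eq`, §1 eq. (1.1) of the paper integrated in time)
   `ν_j∫₀ᵀ‖∇u_j‖² = [E(u_j(0)) − E(u(0))] − [E(u_j(T)) − E(u(T))] + ∫₀ᵀ(∫⟪f_j,u_j⟫ − ∫⟪f,u⟫)`,
   and each bracket tends to `0` by step 2, `|E(a) − E(b)| ≤ ½(‖a−b‖² + 2‖a−b‖‖b‖)` and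
   `|∫⟪f_j,u_j⟫ − ∫⟪f,u⟫| ≤ ‖f_j − f‖‖u_j‖ + ‖f‖‖u_j − u‖`
   (`Torus.IsClassicalNSSolutionOn.tendsto_cumulativeDissipation`).

The hypotheses of the facts are spelled with Mathlib's `eLpNorm · 2 volume`; on the smooth
slices these are `√(∫ ‖·‖²)` (`Torus.toReal_eLpNorm_two_eq_sqrt`), which is how the real-variable
theorems above are fed. All differential identities on `T^d` come from `TorusCalculusProofs` /
`TorusFluidGlueProofs` / `TorusSpaceTime`; the small complements proved here are the linearity
of `Torus.fderiv`, `Torus.partialDeriv`, `Torus.laplacian`, `Torus.convect` and of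
`Torus.IsDivFree` under subtraction, and Cauchy–Schwarz on the torus (the pointwise bound
`‖(w·∇)u‖ ≤ ‖w‖ ∑ᵢ ‖∂ᵢu‖` is `Torus.norm_convect_le` of `TorusFourierModes`).

## References

* E. Bruè, C. De Lellis, *Anomalous dissipation for the forced 3D Navier–Stokes equations*,
  Comm. Math. Phys. 400 (2023) 1507–1533 (arXiv:2207.06301), §1 (p. 3) and Appendix = §9,
  Lemma 7 (arXiv numbering) with its proof. [BrueDeLellis2023]
* C. R. Doering, C. Foias, *Energy dissipation in body-forced turbulence*, J. Fluid Mech. 467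
  (2002), §2, eq. (2.4) (energy balance; `Torus.IsClassicalNSSolutionOn.energy_balance`).
* R. Temam, *Navier–Stokes Equations* (3rd ed., 1984), Ch. II §1.2, Lemma 1.3 (antisymmetry of
  the trilinear form; `Torus.integral_inner_convect_eq_neg`).
* T. Tao, *Localisation and compactness properties of the Navier–Stokes global regularity
  problem*, Anal. PDE 6 (2013), §10 (the continuity method with Grönwall; `NS.bootstrap_gronwall`).
-/

open MeasureTheory Set Filter Topology
open scoped InnerProductSpace ENNReal NNReal ContDiff

noncomputable section

namespace Literature.Barriers.AnomalousDissipation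

namespace Torus

variable {d : Type*} [Fintype d] [DecidableEq d]

/-! ## Pointwise glue on the torus -/

section Pointwise

variable {F : Type*} [NormedAddCommGroup F] [NormedSpace ℝ F]

omit [DecidableEq d] in
/-- `D(a - b)(x) = Da(x) - Db(x)` for `C¹` fields on the torus. [folklore] -/
theorem fderiv_sub {a b : UnitAddTorus d → F} (ha : Literature.Analysis.FunctionSpaces.Torus.IsContDiff 1 a) (hb : Literature.Analysis.FunctionSpaces.Torus.IsContDiff 1 b)
    (x : UnitAddTorus d) : Literature.Analysis.FunctionSpaces.Torus.fderiv (a - b) x = Literature.Analysis.FunctionSpaces.Torus.fderiv a x - Literature.Analysis.FunctionSpaces.Torus.fderiv b x := by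
  have hda : DifferentiableAt ℝ (Literature.Analysis.FunctionSpaces.Torus.liftAt a x) 0 :=
    ((ha.liftAt x).differentiable one_ne_zero).differentiableAt
  have hdb : DifferentiableAt ℝ (Literature.Analysis.FunctionSpaces.Torus.liftAt b x) 0 :=
    ((hb.liftAt x).differentiable one_ne_zero).differentiableAt
  have h : Literature.Analysis.FunctionSpaces.Torus.liftAt (a - b) x = fun v => Literature.Analysis.FunctionSpaces.Torus.liftAt a x v - Literature.Analysis.FunctionSpaces.Torus.liftAt b x v := rfl
  rw [Literature.Analysis.FunctionSpaces.Torus.fderiv, h, fderiv_fun_sub hda hdb]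
  rfl

omit [DecidableEq d] in
/-- The convective derivative is additive in the transported field: `(w·∇)(a - b) =
(w·∇)a - (w·∇)b` for `C¹` fields. [folklore] -/
theorem convect_sub_right {w : UnitAddTorus d → EuclideanSpace ℝ d} {a b : UnitAddTorus d → F}
    (ha : Literature.Analysis.FunctionSpaces.Torus.IsContDiff 1 a) (hb : Literature.Analysis.FunctionSpaces.Torus.IsContDiff 1 b) (x : UnitAddTorus d) :
    Literature.Analysis.FunctionSpaces.Torus.convect w (a - b) x = Literature.Analysis.FunctionSpaces.Torus.convect w a x - Literature.Analysis.FunctionSpaces.Torus.convect w b x := by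
  rw [Literature.Analysis.FunctionSpaces.Torus.convect, fderiv_sub ha hb]
  rfl

omit [Fintype d] [DecidableEq d] in
/-- The convective derivative is additive in the transporting field: `((w₁ - w₂)·∇)a =
(w₁·∇)a - (w₂·∇)a`. [folklore] -/
theorem convect_sub_left (w₁ w₂ : UnitAddTorus d → EuclideanSpace ℝ d) (a : UnitAddTorus d → F)
    (x : UnitAddTorus d) : Literature.Analysis.FunctionSpaces.Torus.convect (w₁ - w₂) a x = Literature.Analysis.FunctionSpaces.Torus.convect w₁ a x - Literature.Analysis.FunctionSpaces.Torus.convect w₂ a x := by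
  simp [Literature.Analysis.FunctionSpaces.Torus.convect, map_sub]

/-- Differences of `C¹` divergence-free fields are divergence free. [folklore] -/
theorem _root_.Literature.Analysis.FunctionSpaces.Torus.IsDivFree.sub {a b : UnitAddTorus d → EuclideanSpace ℝ d} (ha : Literature.Analysis.FunctionSpaces.Torus.IsContDiff 1 a)
    (hb : Literature.Analysis.FunctionSpaces.Torus.IsContDiff 1 b) (hda : Literature.Analysis.FunctionSpaces.Torus.IsDivFree a) (hdb : Literature.Analysis.FunctionSpaces.Torus.IsDivFree b) : Literature.Analysis.FunctionSpaces.Torus.IsDivFree (a - b) := by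
  intro x
  have hab : Literature.Analysis.FunctionSpaces.Torus.IsContDiff 1 (a - b) := ContDiff.sub ha hb
  rw [Literature.Analysis.FunctionSpaces.Torus.divergence_eq_trace_fderiv hab, fderiv_sub ha hb, ContinuousLinearMap.toLinearMap_sub, map_sub,
    ← Literature.Analysis.FunctionSpaces.Torus.divergence_eq_trace_fderiv ha, ← Literature.Analysis.FunctionSpaces.Torus.divergence_eq_trace_fderiv hb, hda x, hdb x, sub_zero]

end Pointwise

/-! ## `L²` glue: Cauchy–Schwarz and the `L²` norm as a square root -/

section L2

omit [DecidableEq d] in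
/-- `‖v‖_{L²}` (as a real number) is `√(∫ ‖v‖²)` for `v ∈ L²`. [folklore] -/
theorem toReal_eLpNorm_two_eq_sqrt {X : Type*} [MeasurableSpace X] {μ : Measure X} {E : Type*}
    [NormedAddCommGroup E] {v : X → E} (hv : MemLp v 2 μ) :
    (eLpNorm v 2 μ).toReal = Real.sqrt (∫ x, ‖v x‖ ^ 2 ∂μ) := by
  rw [hv.eLpNorm_eq_integral_rpow_norm two_ne_zero ENNReal.ofNat_ne_top, ENNReal.toReal_ofNat]
  simp_rw [Real.rpow_two]
  rw [ENNReal.toReal_ofReal (Real.rpow_nonneg (integral_nonneg fun x => sq_nonneg _) _),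
    Real.sqrt_eq_rpow, one_div]

omit [DecidableEq d] in
/-- Cauchy–Schwarz on the torus: `|∫ ⟪F, w⟫| ≤ √(∫ ‖F‖²) √(∫ ‖w‖²)` for continuous fields. [folklore] -/
theorem abs_integral_inner_le_sqrt_mul_sqrt {F w : UnitAddTorus d → EuclideanSpace ℝ d}
    (hF : Continuous F) (hw : Continuous w) :
    |∫ x, ⟪F x, w x⟫_ℝ| ≤ Real.sqrt (∫ x, ‖F x‖ ^ 2) * Real.sqrt (∫ x, ‖w x‖ ^ 2) := by
  have hF2 : MemLp F (ENNReal.ofReal 2) volume := by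
    rw [ENNReal.ofReal_ofNat]
    exact hF.memLp_of_hasCompactSupport (HasCompactSupport.of_compactSpace F)
  have hw2 : MemLp w (ENNReal.ofReal 2) volume := by
    rw [ENNReal.ofReal_ofNat]
    exact hw.memLp_of_hasCompactSupport (HasCompactSupport.of_compactSpace w)
  have h := integral_mul_norm_le_Lp_mul_Lq Real.HolderConjugate.two_two hF2 hw2
  calc |∫ x, ⟪F x, w x⟫_ℝ| = ‖∫ x, ⟪F x, w x⟫_ℝ‖ := (Real.norm_eq_abs _).symm
    _ ≤ ∫ x, ‖⟪F x, w x⟫_ℝ‖ := norm_integral_le_integral_norm _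
    _ ≤ ∫ x, ‖F x‖ * ‖w x‖ :=
        integral_mono_of_nonneg (ae_of_all _ fun x => norm_nonneg _)
          ((hF.norm.mul hw.norm).integrable_unitAddTorus)
          (ae_of_all _ fun x => norm_inner_le_norm _ _)
    _ ≤ (∫ x, ‖F x‖ ^ (2 : ℝ)) ^ (1 / 2 : ℝ) * (∫ x, ‖w x‖ ^ (2 : ℝ)) ^ (1 / 2 : ℝ) := h
    _ = Real.sqrt (∫ x, ‖F x‖ ^ 2) * Real.sqrt (∫ x, ‖w x‖ ^ 2) := by
        simp_rw [Real.rpow_two, Real.sqrt_eq_rpow]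

omit [DecidableEq d] in
/-- `∫ ‖w‖ ≤ (1 + ∫ ‖w‖²)/2` on the probability space `T^d` (`‖w‖ ≤ (1 + ‖w‖²)/2` pointwise). [folklore] -/
theorem integral_norm_le_half_one_add {w : UnitAddTorus d → EuclideanSpace ℝ d} (hw : Continuous w) :
    ∫ x, ‖w x‖ ≤ (1 + ∫ x, ‖w x‖ ^ 2) / 2 := by
  have h1 : ∫ x, ‖w x‖ ≤ ∫ x, (1 + ‖w x‖ ^ 2) / 2 := by
    refine integral_mono hw.norm.integrable_unitAddTorus
      ((continuous_const.add (hw.norm.pow 2)).div_const _).integrable_unitAddTorus fun x => ?_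
    have h0 : 0 ≤ (‖w x‖ - 1) ^ 2 := sq_nonneg _
    simp only
    nlinarith
  refine h1.trans_eq ?_
  have hi2 : Integrable (fun x => ‖w x‖ ^ 2) volume := (hw.norm.pow 2).integrable_unitAddTorus
  rw [integral_div, integral_add (integrable_const _) hi2]
  simp

/-- `√y ≤ (1 + y)/2` for `y ≥ 0`. [folklore] -/
theorem sqrt_le_half_one_add {y : ℝ} (hy : 0 ≤ y) : Real.sqrt y ≤ (1 + y) / 2 := by
  have h0 : 0 ≤ (Real.sqrt y - 1) ^ 2 := sq_nonneg _
  have h1 : Real.sqrt y ^ 2 = y := Real.sq_sqrt hy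
  nlinarith

end L2

/-! ## Linearity of the torus Laplacian on smooth fields -/

section Laplacian

variable {F : Type*} [NormedAddCommGroup F] [NormedSpace ℝ F]

/-- `∂ᵢ(a - b) = ∂ᵢa - ∂ᵢb` for `C¹` fields on the torus. [folklore] -/
theorem partialDeriv_sub {a b : UnitAddTorus d → F} (ha : Literature.Analysis.FunctionSpaces.Torus.IsContDiff 1 a) (hb : Literature.Analysis.FunctionSpaces.Torus.IsContDiff 1 b)
    (i : d) : Literature.Analysis.FunctionSpaces.Torus.partialDeriv i (a - b) = fun x => Literature.Analysis.FunctionSpaces.Torus.partialDeriv i a x - Literature.Analysis.FunctionSpaces.Torus.partialDeriv i b x := by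
  funext x
  have hab : Literature.Analysis.FunctionSpaces.Torus.IsContDiff 1 (a - b) := ContDiff.sub ha hb
  rw [Literature.Analysis.FunctionSpaces.Torus.partialDeriv_eq_fderiv_apply hab, Literature.Analysis.FunctionSpaces.Torus.partialDeriv_eq_fderiv_apply ha,
    Literature.Analysis.FunctionSpaces.Torus.partialDeriv_eq_fderiv_apply hb, fderiv_sub ha hb]
  rfl

/-- `Δ(a - b) = Δa - Δb` for smooth fields on the torus (`Δ = ∑ᵢ ∂ᵢ∂ᵢ`). [folklore] -/
theorem laplacian_sub {a b : UnitAddTorus d → F} (ha : Literature.Analysis.FunctionSpaces.Torus.IsSmooth a) (hb : Literature.Analysis.FunctionSpaces.Torus.IsSmooth b)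
    (x : UnitAddTorus d) : Literature.Analysis.FunctionSpaces.Torus.laplacian (a - b) x = Literature.Analysis.FunctionSpaces.Torus.laplacian a x - Literature.Analysis.FunctionSpaces.Torus.laplacian b x := by
  rw [Literature.Analysis.FunctionSpaces.Torus.laplacian_eq_sum_partialDeriv_partialDeriv (ha.sub hb),
    Literature.Analysis.FunctionSpaces.Torus.laplacian_eq_sum_partialDeriv_partialDeriv ha, Literature.Analysis.FunctionSpaces.Torus.laplacian_eq_sum_partialDeriv_partialDeriv hb,
    ← Finset.sum_sub_distrib]
  refine Finset.sum_congr rfl fun i _ => ?_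
  rw [partialDeriv_sub (ha.isContDiff (by simp)) (hb.isContDiff (by simp)) i]
  have h : (fun x => Literature.Analysis.FunctionSpaces.Torus.partialDeriv i a x - Literature.Analysis.FunctionSpaces.Torus.partialDeriv i b x) = Literature.Analysis.FunctionSpaces.Torus.partialDeriv i a - Literature.Analysis.FunctionSpaces.Torus.partialDeriv i b :=
    rfl
  rw [h, partialDeriv_sub ((ha.partialDeriv i).isContDiff (by simp))
    ((hb.partialDeriv i).isContDiff (by simp)) i]

end Laplacian

/-! ## Classical solutions: the `L²`-stability computation of Bruè–De Lellis, Lemma 7 -/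

section Stability

variable {S : Set ℝ} {ν : ℝ} {f u : ℝ → UnitAddTorus d → EuclideanSpace ℝ d}
  {p : ℝ → UnitAddTorus d → ℝ}

/-- The force of a classical solution on `[0, T] × T^d`, `T > 0`, is jointly smooth:
`f = ∂ₜu + (u·∇)u − νΔu + ∇p` by the momentum equation, and the right-hand side is jointly
smooth on the interval `[0, T]` (a set of unique differentiability). This is the case used below
of the torus twin (file-private in `TorusClassicalLerayHopfProofs`) of the whole-space
`Literature.Analysis.FluidPDE.IsClassicalNSSolutionOn.isSmoothSpaceTimeOn_force`. [folklore] -/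
theorem _root_.Literature.Analysis.FunctionSpaces.Torus.IsClassicalNSSolutionOn.force_isSmoothSpaceTimeOn_Icc {T : ℝ} (hT : 0 < T)
    (h : Literature.Analysis.FunctionSpaces.Torus.IsClassicalNSSolutionOn (Icc 0 T) ν f u p) :
    Literature.Analysis.FunctionSpaces.Torus.IsSmoothSpaceTimeOn (Icc 0 T) f := by
  set S : Set ℝ := Icc 0 T with hS_def
  have hU : UniqueDiffOn ℝ S := uniqueDiffOn_Icc hT
  have hu := h.smooth_velocity
  have hG : Literature.Analysis.FunctionSpaces.Torus.IsSmoothSpaceTimeOn S (fun t x => Literature.Analysis.FunctionSpaces.Torus.timeDerivWithin S u t x + Literature.Analysis.FunctionSpaces.Torus.convect (u t) (u t) x -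
      ν • Literature.Analysis.FunctionSpaces.Torus.laplacian (u t) x + Literature.Analysis.FunctionSpaces.Torus.gradient (p t) x) :=
    (((hu.timeDerivWithin hU).add (hu.convect hu hU)).sub ((hu.laplacian hU).const_smul ν)).add
      (h.smooth_pressure.gradient hU)
  refine ContDiffOn.congr hG fun z hz => ?_
  obtain ⟨t, y⟩ := z
  have ht : t ∈ S := (mem_prod.1 hz).1
  simp only [Literature.Analysis.FunctionSpaces.Torus.stLift_apply]
  rw [h.momentum t ht (Literature.Analysis.FunctionSpaces.Torus.proj y)]
  abel

/-- The momentum equation solved for the time derivative: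
`∂ₜu = νΔu − ∇p + f − (u·∇)u`. [folklore] -/
theorem _root_.Literature.Analysis.FunctionSpaces.Torus.IsClassicalNSSolutionOn.timeDerivWithin_eq (h : Literature.Analysis.FunctionSpaces.Torus.IsClassicalNSSolutionOn S ν f u p)
    {t : ℝ} (ht : t ∈ S) (x : UnitAddTorus d) :
    Literature.Analysis.FunctionSpaces.Torus.timeDerivWithin S u t x =
      ν • Literature.Analysis.FunctionSpaces.Torus.laplacian (u t) x - Literature.Analysis.FunctionSpaces.Torus.gradient (p t) x + f t x - Literature.Analysis.FunctionSpaces.Torus.convect (u t) (u t) x :=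
  eq_sub_of_add_eq (h.momentum t ht x)

omit [DecidableEq d] in
/-- Differentiating `∫ ‖a − b‖²` under the integral sign within a convex time set of unique
differentiability: `d/dt ∫ ‖a − b‖² = 2 ∫ ⟪a − b, ∂ₜa − ∂ₜb⟫`. [folklore] -/
theorem hasDerivWithinAt_integral_norm_sub_sq {a b : ℝ → UnitAddTorus d → EuclideanSpace ℝ d}
    (hS : Convex ℝ S) (hU : UniqueDiffOn ℝ S) (ha : Literature.Analysis.FunctionSpaces.Torus.IsSmoothSpaceTimeOn S a)
    (hb : Literature.Analysis.FunctionSpaces.Torus.IsSmoothSpaceTimeOn S b) {t : ℝ} (ht : t ∈ S) :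
    HasDerivWithinAt (fun s => ∫ x, ‖a s x - b s x‖ ^ 2)
      (2 * ∫ x, ⟪a t x - b t x, Literature.Analysis.FunctionSpaces.Torus.timeDerivWithin S a t x - Literature.Analysis.FunctionSpaces.Torus.timeDerivWithin S b t x⟫_ℝ) S t := by
  have hφ : Literature.Analysis.FunctionSpaces.Torus.IsSmoothSpaceTimeOn S (fun s x => ‖a s x - b s x‖ ^ 2) := (ha.sub hb).normSq
  have h := hφ.hasDerivWithinAt_integral hS ht
  have hpt : ∀ x, Literature.Analysis.FunctionSpaces.Torus.timeDerivWithin S (fun s x => ‖a s x - b s x‖ ^ 2) t x =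
      2 * ⟪a t x - b t x, Literature.Analysis.FunctionSpaces.Torus.timeDerivWithin S a t x - Literature.Analysis.FunctionSpaces.Torus.timeDerivWithin S b t x⟫_ℝ := by
    intro x
    have h1 : HasDerivWithinAt (fun τ => a τ x - b τ x)
        (Literature.Analysis.FunctionSpaces.Torus.timeDerivWithin S a t x - Literature.Analysis.FunctionSpaces.Torus.timeDerivWithin S b t x) S t :=
      (ha.hasDerivWithinAt_slice ht x).sub (hb.hasDerivWithinAt_slice ht x)
    exact (h1.norm_sq).derivWithin (hU t ht)
  simp_rw [hpt, integral_const_mul] at h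
  exact h

/-- **The `L²`-stability inequality (Bruè–De Lellis 2023, Appendix, proof of Lemma 7).** For a
classical forced Euler solution `(u, p, f)` and a classical Navier–Stokes solution
`(uν, pν, fν)` with viscosity `ν ≥ 0` on `[0, T] × T^d`, writing `w = uν − u`,
`y = ∫ ‖w‖²`, the pairing `∫ ⟪w, ∂ₜw⟫ = ½ y'` is bounded by
`L y + ν C_Δ (1 + y)/2 + ‖fν − f‖_{L²} (1 + y)/2`, where `L` bounds `∑ᵢ ‖∂ᵢu(t)‖` and `C_Δ`
bounds `‖Δu(t)‖` pointwise: subtract the equations,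
pair with the divergence-free `w`; the pressures drop out, `∫ ⟪(uν·∇)w, w⟫ = 0`,
`|∫ ⟪(w·∇)u, w⟫| ≤ ‖∇u‖_∞ ∫‖w‖²`, `ν∫ ⟪w, Δuν⟫ = −ν‖∇w‖² + ν∫⟪w, Δu⟫ ≤ ν C_Δ ∫ ‖w‖`, and
Cauchy–Schwarz for the forces (with `∫‖w‖, ‖w‖_{L²} ≤ (1 + y)/2`). [cite: BrueDeLellis2023, Appendix, Lemma 7 (arXiv numbering)] -/
theorem _root_.Literature.Analysis.FunctionSpaces.Torus.IsClassicalNSSolutionOn.integral_inner_timeDerivWithin_sub_le {T : ℝ} (hT : 0 < T)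
    {fν uν : ℝ → UnitAddTorus d → EuclideanSpace ℝ d} {pν : ℝ → UnitAddTorus d → ℝ}
    (hE : Literature.Analysis.FunctionSpaces.Torus.IsClassicalNSSolutionOn (Icc 0 T) 0 f u p)
    (hN : Literature.Analysis.FunctionSpaces.Torus.IsClassicalNSSolutionOn (Icc 0 T) ν fν uν pν) (hν : 0 ≤ ν) {t : ℝ} (ht : t ∈ Icc 0 T)
    {L CΔ : ℝ} (hL : ∀ x, ∑ i, ‖Literature.Analysis.FunctionSpaces.Torus.partialDeriv i (u t) x‖ ≤ L)
    (hCΔ : ∀ x, ‖Literature.Analysis.FunctionSpaces.Torus.laplacian (u t) x‖ ≤ CΔ) :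
    ∫ x, ⟪uν t x - u t x,
        Literature.Analysis.FunctionSpaces.Torus.timeDerivWithin (Icc 0 T) uν t x - Literature.Analysis.FunctionSpaces.Torus.timeDerivWithin (Icc 0 T) u t x⟫_ℝ ≤
      L * (∫ x, ‖uν t x - u t x‖ ^ 2)
        + ν * (CΔ * ((1 + ∫ x, ‖uν t x - u t x‖ ^ 2) / 2))
        + Real.sqrt (∫ x, ‖fν t x - f t x‖ ^ 2) * ((1 + ∫ x, ‖uν t x - u t x‖ ^ 2) / 2) := by
  set S : Set ℝ := Icc 0 T with hS_def
  have hU : UniqueDiffOn ℝ S := uniqueDiffOn_Icc hT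
  have hut : Literature.Analysis.FunctionSpaces.Torus.IsSmooth (u t) := hE.smooth_velocity.isSmooth_slice ht
  have huνt : Literature.Analysis.FunctionSpaces.Torus.IsSmooth (uν t) := hN.smooth_velocity.isSmooth_slice ht
  have hpt : Literature.Analysis.FunctionSpaces.Torus.IsSmooth (p t) := hE.smooth_pressure.isSmooth_slice ht
  have hpνt : Literature.Analysis.FunctionSpaces.Torus.IsSmooth (pν t) := hN.smooth_pressure.isSmooth_slice ht
  have hft : Literature.Analysis.FunctionSpaces.Torus.IsSmooth (f t) := (hE.force_isSmoothSpaceTimeOn_Icc hT).isSmooth_slice ht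
  have hfνt : Literature.Analysis.FunctionSpaces.Torus.IsSmooth (fν t) := (hN.force_isSmoothSpaceTimeOn_Icc hT).isSmooth_slice ht
  set w : UnitAddTorus d → EuclideanSpace ℝ d := uν t - u t with hw_def
  have hw : Literature.Analysis.FunctionSpaces.Torus.IsSmooth w := huνt.sub hut
  have hw1 : Literature.Analysis.FunctionSpaces.Torus.IsContDiff 1 w := hw.isContDiff (by simp)
  have hu1 : Literature.Analysis.FunctionSpaces.Torus.IsContDiff 1 (u t) := hut.isContDiff (by simp)
  have huν1 : Literature.Analysis.FunctionSpaces.Torus.IsContDiff 1 (uν t) := huνt.isContDiff (by simp)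
  have hwdiv : Literature.Analysis.FunctionSpaces.Torus.IsDivFree w := Literature.Analysis.FunctionSpaces.Torus.IsDivFree.sub huν1 hu1 (hN.divFree t ht) (hE.divFree t ht)
  have hwx : ∀ x, uν t x - u t x = w x := fun x => rfl
  simp_rw [hwx]
  -- the convective terms: `(uν·∇)uν − (u·∇)u = (uν·∇)w + (w·∇)u`
  have hconv : ∀ x, Literature.Analysis.FunctionSpaces.Torus.convect (uν t) (uν t) x - Literature.Analysis.FunctionSpaces.Torus.convect (u t) (u t) x =
      Literature.Analysis.FunctionSpaces.Torus.convect (uν t) w x + Literature.Analysis.FunctionSpaces.Torus.convect w (u t) x := by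
    intro x
    rw [hw_def, convect_sub_right huν1 hu1, convect_sub_left]
    abel
  -- pointwise form of the integrand
  have hid : ∀ x, ⟪w x, Literature.Analysis.FunctionSpaces.Torus.timeDerivWithin S uν t x - Literature.Analysis.FunctionSpaces.Torus.timeDerivWithin S u t x⟫_ℝ =
      ν * (⟪w x, Literature.Analysis.FunctionSpaces.Torus.laplacian w x⟫_ℝ + ⟪w x, Literature.Analysis.FunctionSpaces.Torus.laplacian (u t) x⟫_ℝ)
        - ⟪Literature.Analysis.FunctionSpaces.Torus.gradient (pν t) x, w x⟫_ℝ + ⟪Literature.Analysis.FunctionSpaces.Torus.gradient (p t) x, w x⟫_ℝ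
        + ⟪fν t x - f t x, w x⟫_ℝ
        - ⟪Literature.Analysis.FunctionSpaces.Torus.convect (uν t) w x, w x⟫_ℝ - ⟪Literature.Analysis.FunctionSpaces.Torus.convect w (u t) x, w x⟫_ℝ := by
    intro x
    have hlap : Literature.Analysis.FunctionSpaces.Torus.laplacian (uν t) x = Literature.Analysis.FunctionSpaces.Torus.laplacian w x + Literature.Analysis.FunctionSpaces.Torus.laplacian (u t) x := by
      rw [hw_def, laplacian_sub huνt hut]; abel
    have hA : Literature.Analysis.FunctionSpaces.Torus.timeDerivWithin S uν t x - Literature.Analysis.FunctionSpaces.Torus.timeDerivWithin S u t x =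
        ν • (Literature.Analysis.FunctionSpaces.Torus.laplacian w x + Literature.Analysis.FunctionSpaces.Torus.laplacian (u t) x) - (Literature.Analysis.FunctionSpaces.Torus.gradient (pν t) x - Literature.Analysis.FunctionSpaces.Torus.gradient (p t) x)
          + (fν t x - f t x) - (Literature.Analysis.FunctionSpaces.Torus.convect (uν t) w x + Literature.Analysis.FunctionSpaces.Torus.convect w (u t) x) := by
      rw [hN.timeDerivWithin_eq ht x, hE.timeDerivWithin_eq ht x, zero_smul, zero_sub, ← hconv,
        hlap]
      abel
    rw [hA]
    simp only [inner_sub_right, inner_add_right, real_inner_smul_right, real_inner_comm (w x)]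
    ring
  -- integrability of every term
  have i1a : Integrable (fun x => ⟪w x, Literature.Analysis.FunctionSpaces.Torus.laplacian w x⟫_ℝ) volume := (hw.inner hw.laplacian).integrable
  have i1b : Integrable (fun x => ⟪w x, Literature.Analysis.FunctionSpaces.Torus.laplacian (u t) x⟫_ℝ) volume :=
    (hw.inner hut.laplacian).integrable
  have i1 : Integrable (fun x => ν * (⟪w x, Literature.Analysis.FunctionSpaces.Torus.laplacian w x⟫_ℝ + ⟪w x, Literature.Analysis.FunctionSpaces.Torus.laplacian (u t) x⟫_ℝ))
      volume := (i1a.add i1b).const_mul ν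
  have i2 : Integrable (fun x => ⟪Literature.Analysis.FunctionSpaces.Torus.gradient (pν t) x, w x⟫_ℝ) volume :=
    (hpνt.gradient.inner hw).integrable
  have i3 : Integrable (fun x => ⟪Literature.Analysis.FunctionSpaces.Torus.gradient (p t) x, w x⟫_ℝ) volume :=
    (hpt.gradient.inner hw).integrable
  have i4 : Integrable (fun x => ⟪fν t x - f t x, w x⟫_ℝ) volume :=
    ((hfνt.sub hft).inner hw).integrable
  have i5 : Integrable (fun x => ⟪Literature.Analysis.FunctionSpaces.Torus.convect (uν t) w x, w x⟫_ℝ) volume :=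
    ((huνt.convect hw).inner hw).integrable
  have i6 : Integrable (fun x => ⟪Literature.Analysis.FunctionSpaces.Torus.convect w (u t) x, w x⟫_ℝ) volume :=
    ((hw.convect hut).inner hw).integrable
  have i12 : Integrable (fun x => ν * (⟪w x, Literature.Analysis.FunctionSpaces.Torus.laplacian w x⟫_ℝ + ⟪w x, Literature.Analysis.FunctionSpaces.Torus.laplacian (u t) x⟫_ℝ)
      - ⟪Literature.Analysis.FunctionSpaces.Torus.gradient (pν t) x, w x⟫_ℝ) volume := i1.sub i2
  have i123 : Integrable (fun x => ν * (⟪w x, Literature.Analysis.FunctionSpaces.Torus.laplacian w x⟫_ℝ + ⟪w x, Literature.Analysis.FunctionSpaces.Torus.laplacian (u t) x⟫_ℝ)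
      - ⟪Literature.Analysis.FunctionSpaces.Torus.gradient (pν t) x, w x⟫_ℝ + ⟪Literature.Analysis.FunctionSpaces.Torus.gradient (p t) x, w x⟫_ℝ) volume := i12.add i3
  have i1234 : Integrable (fun x => ν * (⟪w x, Literature.Analysis.FunctionSpaces.Torus.laplacian w x⟫_ℝ + ⟪w x, Literature.Analysis.FunctionSpaces.Torus.laplacian (u t) x⟫_ℝ)
      - ⟪Literature.Analysis.FunctionSpaces.Torus.gradient (pν t) x, w x⟫_ℝ + ⟪Literature.Analysis.FunctionSpaces.Torus.gradient (p t) x, w x⟫_ℝ + ⟪fν t x - f t x, w x⟫_ℝ)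
      volume := i123.add i4
  have i12345 : Integrable (fun x => ν * (⟪w x, Literature.Analysis.FunctionSpaces.Torus.laplacian w x⟫_ℝ + ⟪w x, Literature.Analysis.FunctionSpaces.Torus.laplacian (u t) x⟫_ℝ)
      - ⟪Literature.Analysis.FunctionSpaces.Torus.gradient (pν t) x, w x⟫_ℝ + ⟪Literature.Analysis.FunctionSpaces.Torus.gradient (p t) x, w x⟫_ℝ + ⟪fν t x - f t x, w x⟫_ℝ
      - ⟪Literature.Analysis.FunctionSpaces.Torus.convect (uν t) w x, w x⟫_ℝ) volume := i1234.sub i5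
  have hsplit : ∫ x, ⟪w x, Literature.Analysis.FunctionSpaces.Torus.timeDerivWithin S uν t x - Literature.Analysis.FunctionSpaces.Torus.timeDerivWithin S u t x⟫_ℝ =
      ν * ((∫ x, ⟪w x, Literature.Analysis.FunctionSpaces.Torus.laplacian w x⟫_ℝ) + ∫ x, ⟪w x, Literature.Analysis.FunctionSpaces.Torus.laplacian (u t) x⟫_ℝ)
        - (∫ x, ⟪Literature.Analysis.FunctionSpaces.Torus.gradient (pν t) x, w x⟫_ℝ) + (∫ x, ⟪Literature.Analysis.FunctionSpaces.Torus.gradient (p t) x, w x⟫_ℝ)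
        + (∫ x, ⟪fν t x - f t x, w x⟫_ℝ)
        - (∫ x, ⟪Literature.Analysis.FunctionSpaces.Torus.convect (uν t) w x, w x⟫_ℝ) - ∫ x, ⟪Literature.Analysis.FunctionSpaces.Torus.convect w (u t) x, w x⟫_ℝ := by
    rw [integral_congr_ae (ae_of_all _ hid), integral_sub i12345 i6, integral_sub i1234 i5,
      integral_add i123 i4, integral_add i12 i3, integral_sub i1 i2, integral_const_mul,
      integral_add i1a i1b]
  -- the individual terms
  have hy0 : 0 ≤ ∫ x, ‖w x‖ ^ 2 := integral_nonneg fun x => sq_nonneg _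
  have hCΔ0 : 0 ≤ CΔ := (norm_nonneg _).trans (hCΔ 0)
  have hnorm : ∫ x, ‖w x‖ ≤ (1 + ∫ x, ‖w x‖ ^ 2) / 2 := integral_norm_le_half_one_add hw.continuous
  -- (1a) `∫ ⟪w, Δw⟫ = -‖∇w‖² ≤ 0`
  have h1a : ∫ x, ⟪w x, Literature.Analysis.FunctionSpaces.Torus.laplacian w x⟫_ℝ ≤ 0 := by
    rw [Literature.Analysis.FunctionSpaces.Torus.integral_inner_laplacian_eq_neg_holds hw, neg_nonpos]
    exact Finset.sum_nonneg fun i _ => integral_nonneg fun x => sq_nonneg _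
  -- (1b) `|∫ ⟪w, Δu⟫| ≤ C_Δ ∫ ‖w‖`
  have h1b : ∫ x, ⟪w x, Literature.Analysis.FunctionSpaces.Torus.laplacian (u t) x⟫_ℝ ≤ CΔ * ((1 + ∫ x, ‖w x‖ ^ 2) / 2) := by
    calc ∫ x, ⟪w x, Literature.Analysis.FunctionSpaces.Torus.laplacian (u t) x⟫_ℝ ≤ ∫ x, CΔ * ‖w x‖ := by
          refine integral_mono i1b (hw.continuous.norm.integrable_unitAddTorus.const_mul CΔ)
            fun x => ?_
          calc ⟪w x, Literature.Analysis.FunctionSpaces.Torus.laplacian (u t) x⟫_ℝ ≤ ‖w x‖ * ‖Literature.Analysis.FunctionSpaces.Torus.laplacian (u t) x‖ := real_inner_le_norm _ _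
            _ ≤ ‖w x‖ * CΔ := by gcongr; exact hCΔ x
            _ = CΔ * ‖w x‖ := mul_comm _ _
      _ = CΔ * ∫ x, ‖w x‖ := integral_const_mul _ _
      _ ≤ CΔ * ((1 + ∫ x, ‖w x‖ ^ 2) / 2) := mul_le_mul_of_nonneg_left hnorm hCΔ0
  -- (2), (3) the pressures drop out
  have h2 : ∫ x, ⟪Literature.Analysis.FunctionSpaces.Torus.gradient (pν t) x, w x⟫_ℝ = 0 :=
    Literature.Analysis.FunctionSpaces.Torus.integral_inner_gradient_eq_zero_of_isDivFree hw hpνt hwdiv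
  have h3 : ∫ x, ⟪Literature.Analysis.FunctionSpaces.Torus.gradient (p t) x, w x⟫_ℝ = 0 :=
    Literature.Analysis.FunctionSpaces.Torus.integral_inner_gradient_eq_zero_of_isDivFree hw hpt hwdiv
  -- (4) Cauchy–Schwarz for the forces
  have h4 : ∫ x, ⟪fν t x - f t x, w x⟫_ℝ ≤
      Real.sqrt (∫ x, ‖fν t x - f t x‖ ^ 2) * ((1 + ∫ x, ‖w x‖ ^ 2) / 2) := by
    refine (le_abs_self _).trans ((abs_integral_inner_le_sqrt_mul_sqrt (hfνt.sub hft).continuous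
      hw.continuous).trans ?_)
    exact mul_le_mul_of_nonneg_left (sqrt_le_half_one_add hy0) (Real.sqrt_nonneg _)
  -- (5) `∫ ⟪(uν·∇)w, w⟫ = 0`
  have h5 : ∫ x, ⟪Literature.Analysis.FunctionSpaces.Torus.convect (uν t) w x, w x⟫_ℝ = 0 := by
    have h := Literature.Analysis.FunctionSpaces.Torus.integral_inner_convect_eq_neg huνt (hN.divFree t ht) hw hw
    have h' : ∫ x, ⟪w x, Literature.Analysis.FunctionSpaces.Torus.convect (uν t) w x⟫_ℝ = ∫ x, ⟪Literature.Analysis.FunctionSpaces.Torus.convect (uν t) w x, w x⟫_ℝ :=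
      integral_congr_ae (ae_of_all _ fun x => real_inner_comm _ _)
    linarith
  -- (6) `|∫ ⟪(w·∇)u, w⟫| ≤ L ∫ ‖w‖²` (`‖(w·∇)u‖ ≤ ‖w‖ ∑ᵢ ‖∂ᵢu‖`, `Torus.norm_convect_le`)
  have h6 : -∫ x, ⟪Literature.Analysis.FunctionSpaces.Torus.convect w (u t) x, w x⟫_ℝ ≤ L * ∫ x, ‖w x‖ ^ 2 := by
    rw [← integral_neg, ← integral_const_mul]
    refine integral_mono i6.neg (hw.norm_sq.integrable.const_mul _) fun x => ?_
    calc -⟪Literature.Analysis.FunctionSpaces.Torus.convect w (u t) x, w x⟫_ℝ ≤ |⟪Literature.Analysis.FunctionSpaces.Torus.convect w (u t) x, w x⟫_ℝ| := neg_le_abs _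
      _ ≤ ‖Literature.Analysis.FunctionSpaces.Torus.convect w (u t) x‖ * ‖w x‖ := abs_real_inner_le_norm _ _
      _ ≤ ‖w x‖ * L * ‖w x‖ :=
          mul_le_mul_of_nonneg_right ((Literature.Analysis.FunctionSpaces.Torus.norm_convect_le w hu1 x).trans
            (mul_le_mul_of_nonneg_left (hL x) (norm_nonneg _))) (norm_nonneg _)
      _ = L * ‖w x‖ ^ 2 := by ring
  rw [hsplit, h2, h3, h5]
  have h1 : ν * ((∫ x, ⟪w x, Literature.Analysis.FunctionSpaces.Torus.laplacian w x⟫_ℝ) + ∫ x, ⟪w x, Literature.Analysis.FunctionSpaces.Torus.laplacian (u t) x⟫_ℝ) ≤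
      ν * (CΔ * ((1 + ∫ x, ‖w x‖ ^ 2) / 2)) :=
    mul_le_mul_of_nonneg_left (by linarith) hν
  linarith

end Stability

/-! ## Grönwall: uniform `L²` convergence on `[0, T]` -/

section Gronwall

variable {f u : ℝ → UnitAddTorus d → EuclideanSpace ℝ d} {p : ℝ → UnitAddTorus d → ℝ}

/-- **Grönwall step (Bruè–De Lellis 2023, Appendix, after Lemma 7).** In the situation of
`integral_inner_timeDerivWithin_sub_le` with `0 < ν ≤ 1`, uniform bounds `L` on `∑ᵢ ‖∂ᵢu‖`
and `C_Δ` on `‖Δu‖` for the Euler velocity on `[0, T] × T^d`, put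
`κ = 2L + C_Δ + 1`, `y(t) = ∫ ‖uν(t) − u(t)‖²`, `Γ = ∫₀ᵀ ‖fν − f‖_{L²} dt` and
`M = e^{κT} (y(0) + 2Γ + ν C_Δ T)`. If `M < 1` then `y(t) ≤ M` for all `t ∈ [0, T]`
(continuity method: while `y ≤ 1` the stability inequality reads `y' ≤ κ y + 2‖fν − f‖_{L²} +
ν C_Δ`, and Grönwall's bound `M < 1` closes the bootstrap). [cite: BrueDeLellis2023, Appendix, Lemma 7 (arXiv numbering)] -/
theorem _root_.Literature.Analysis.FunctionSpaces.Torus.IsClassicalNSSolutionOn.integral_norm_sub_sq_le_of_lt_one {T ν : ℝ} (hT : 0 < T)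
    {fν uν : ℝ → UnitAddTorus d → EuclideanSpace ℝ d} {pν : ℝ → UnitAddTorus d → ℝ}
    (hE : Literature.Analysis.FunctionSpaces.Torus.IsClassicalNSSolutionOn (Icc 0 T) 0 f u p)
    (hN : Literature.Analysis.FunctionSpaces.Torus.IsClassicalNSSolutionOn (Icc 0 T) ν fν uν pν) (hν : 0 < ν) (hν1 : ν ≤ 1)
    {L CΔ : ℝ} (hL0 : 0 ≤ L) (hL : ∀ t ∈ Icc 0 T, ∀ x, ∑ i, ‖Literature.Analysis.FunctionSpaces.Torus.partialDeriv i (u t) x‖ ≤ L)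
    (hCΔ : ∀ t ∈ Icc 0 T, ∀ x, ‖Literature.Analysis.FunctionSpaces.Torus.laplacian (u t) x‖ ≤ CΔ)
    (hM : Real.exp ((2 * L + CΔ + 1) * T) *
        ((∫ x, ‖uν 0 x - u 0 x‖ ^ 2) +
          (2 * (∫ s in (0 : ℝ)..T, Real.sqrt (∫ x, ‖fν s x - f s x‖ ^ 2)) + ν * CΔ * T)) < 1) :
    ∀ t ∈ Icc 0 T, ∫ x, ‖uν t x - u t x‖ ^ 2 ≤
      Real.exp ((2 * L + CΔ + 1) * T) *
        ((∫ x, ‖uν 0 x - u 0 x‖ ^ 2) +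
          (2 * (∫ s in (0 : ℝ)..T, Real.sqrt (∫ x, ‖fν s x - f s x‖ ^ 2)) + ν * CΔ * T)) := by
  set S : Set ℝ := Icc 0 T with hS_def
  have hSc : Convex ℝ S := convex_Icc 0 T
  have hU : UniqueDiffOn ℝ S := uniqueDiffOn_Icc hT
  have h0S : (0 : ℝ) ∈ S := ⟨le_rfl, hT.le⟩
  have hCΔ0 : 0 ≤ CΔ := (norm_nonneg _).trans (hCΔ 0 h0S 0)
  have hu := hE.smooth_velocity
  have huν := hN.smooth_velocity
  have hF : Literature.Analysis.FunctionSpaces.Torus.IsSmoothSpaceTimeOn S (fun t x => fν t x - f t x) :=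
    (hN.force_isSmoothSpaceTimeOn_Icc hT).sub (hE.force_isSmoothSpaceTimeOn_Icc hT)
  -- the functions entering the continuity method
  set W : ℝ → ℝ := fun t => ∫ x, ‖uν t x - u t x‖ ^ 2 with hW_def
  set D : ℝ → ℝ := fun t => 2 * ∫ x, ⟪uν t x - u t x,
    Literature.Analysis.FunctionSpaces.Torus.timeDerivWithin S uν t x - Literature.Analysis.FunctionSpaces.Torus.timeDerivWithin S u t x⟫_ℝ with hD_def
  set g₀ : ℝ → ℝ := fun t => Real.sqrt (∫ x, ‖fν t x - f t x‖ ^ 2) with hg₀_def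
  set g : ℝ → ℝ := fun t => 2 * g₀ t + ν * CΔ with hg_def
  set κ : ℝ := 2 * L + CΔ + 1 with hκ_def
  have hκ : 0 < κ := by positivity
  have hderiv : ∀ t ∈ S, HasDerivWithinAt W (D t) S t := fun t ht =>
    hasDerivWithinAt_integral_norm_sub_sq hSc hU huν hu ht
  have hWc : ContinuousOn W S := fun t ht => (hderiv t ht).continuousWithinAt
  have hD : ∀ t ∈ Ico 0 T, HasDerivWithinAt W (D t) (Ici t) t := fun t ht =>
    (hderiv t (mem_Icc_of_Ico ht)).mono_of_mem_nhdsWithin (Icc_mem_nhdsGE_of_mem ht)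
  have hg₀c : ContinuousOn g₀ S :=
    Real.continuous_sqrt.comp_continuousOn (hF.normSq.continuousOn_integral hSc)
  have hgc : ContinuousOn g S := (continuousOn_const.mul hg₀c).add continuousOn_const
  have hg₀0 : ∀ t, 0 ≤ g₀ t := fun t => Real.sqrt_nonneg _
  have hg0 : ∀ t ∈ Icc 0 T, 0 ≤ g t := fun t _ =>
    add_nonneg (mul_nonneg two_pos.le (hg₀0 t)) (mul_nonneg hν.le hCΔ0)
  have hW0' : ∀ t, 0 ≤ W t := fun t => integral_nonneg fun x => sq_nonneg _
  have hineq : ∀ t ∈ Ico 0 T, W t ≤ 1 → D t ≤ κ * W t + g t := by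
    intro t ht hWt
    have htS : t ∈ S := mem_Icc_of_Ico ht
    have hI := hE.integral_inner_timeDerivWithin_sub_le hT hN hν.le htS (hL t htS) (hCΔ t htS)
    have h1 : ν * CΔ * W t ≤ CΔ * W t := by
      have h := mul_le_mul_of_nonneg_right hν1 (mul_nonneg hCΔ0 (hW0' t))
      linarith
    have h2 : g₀ t * W t ≤ g₀ t := mul_le_of_le_one_right (hg₀0 t) hWt
    have h3 : 0 ≤ W t := hW0' t
    simp only [hD_def, hg_def, hκ_def]
    simp only [hW_def, hg₀_def] at hI h1 h2 h3 ⊢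
    nlinarith [hI, h1, h2, h3]
  -- the Grönwall integral `∫₀ᵀ g = 2Γ + ν C_Δ T`
  have hgi : IntervalIntegrable g₀ volume 0 T := hg₀c.intervalIntegrable_of_Icc hT.le
  have hgint : ∫ s in (0 : ℝ)..T, g s =
      2 * (∫ s in (0 : ℝ)..T, g₀ s) + ν * CΔ * T := by
    simp only [hg_def]
    rw [intervalIntegral.integral_add (hgi.const_mul 2) intervalIntegrable_const,
      intervalIntegral.integral_const_mul, intervalIntegral.integral_const, sub_zero, smul_eq_mul]
    ring
  have hM' : Real.exp (κ * T) * (W 0 + ∫ s in (0 : ℝ)..T, g s) < 1 := by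
    rw [hgint]; exact hM
  intro t ht
  have h := Literature.Analysis.FluidPDE.bootstrap_gronwall hT hκ hWc hD hgc hg0 (hW0' 0) hineq hM' t ht
  rw [hgint] at h
  exact h

/-- **Uniform `L²` convergence (Bruè–De Lellis 2023, Appendix: "if `ν ↓ 0`, `fν → f` in
`L¹([0,T];L²)`, and `uν(·,0) → u(·,0)` in `L²`, then `uν → u` in `C([0,T];L²)`").** For a
classical forced Euler solution on `[0, T]` and classical Navier–Stokes solutions `u_j` with
`ν_j ↓ 0`, `∫₀ᵀ ‖f_j − f‖_{L²} → 0` and `‖u_j(0) − u(0)‖²_{L²} → 0`, there are `M_j → 0`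
with `∫ ‖u_j(t) − u(t)‖² ≤ M_j` for all `t ∈ [0, T]` and all large `j`. [cite: BrueDeLellis2023, Appendix, Lemma 7 (arXiv numbering)] -/
theorem _root_.Literature.Analysis.FunctionSpaces.Torus.IsClassicalNSSolutionOn.exists_uniform_integral_norm_sub_sq_le {T : ℝ} (hT : 0 < T)
    (hE : Literature.Analysis.FunctionSpaces.Torus.IsClassicalNSSolutionOn (Icc 0 T) 0 f u p) {νs : ℕ → ℝ} (hν : ∀ j, 0 < νs j)
    (hν₀ : Tendsto νs atTop (𝓝 0)) {fs us : ℕ → ℝ → UnitAddTorus d → EuclideanSpace ℝ d}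
    {ps : ℕ → ℝ → UnitAddTorus d → ℝ}
    (hN : ∀ j, Literature.Analysis.FunctionSpaces.Torus.IsClassicalNSSolutionOn (Icc 0 T) (νs j) (fs j) (us j) (ps j))
    (hforce : Tendsto (fun j => ∫ t in (0 : ℝ)..T, Real.sqrt (∫ x, ‖fs j t x - f t x‖ ^ 2))
      atTop (𝓝 0))
    (hdata : Tendsto (fun j => ∫ x, ‖us j 0 x - u 0 x‖ ^ 2) atTop (𝓝 0)) :
    ∃ M : ℕ → ℝ, Tendsto M atTop (𝓝 0) ∧
      ∀ᶠ j in atTop, ∀ t ∈ Icc 0 T, ∫ x, ‖us j t x - u t x‖ ^ 2 ≤ M j := by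
  set S : Set ℝ := Icc 0 T with hS_def
  have hU : UniqueDiffOn ℝ S := uniqueDiffOn_Icc hT
  have hu := hE.smooth_velocity
  -- uniform bounds for the Euler solution on `[0, T] × T^d`
  have hLi : ∀ i, ∃ C : ℝ, ∀ t ∈ S, ∀ x, ‖Literature.Analysis.FunctionSpaces.Torus.partialDeriv i (u t) x‖ ≤ C := fun i =>
    (hu.partialDeriv hU i).exists_norm_le_of_isCompact isCompact_Icc subset_rfl
  choose C hC using hLi
  set L : ℝ := ∑ i, |C i| with hL_def
  have hL0 : 0 ≤ L := Finset.sum_nonneg fun i _ => abs_nonneg _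
  have hL : ∀ t ∈ S, ∀ x, ∑ i, ‖Literature.Analysis.FunctionSpaces.Torus.partialDeriv i (u t) x‖ ≤ L := fun t ht x =>
    Finset.sum_le_sum fun i _ => (hC i t ht x).trans (le_abs_self _)
  obtain ⟨CΔ', hCΔ'⟩ := (hu.laplacian hU).exists_norm_le_of_isCompact isCompact_Icc subset_rfl
  set CΔ : ℝ := |CΔ'| with hCΔ_def
  have hCΔ : ∀ t ∈ S, ∀ x, ‖Literature.Analysis.FunctionSpaces.Torus.laplacian (u t) x‖ ≤ CΔ := fun t ht x =>
    (hCΔ' t ht x).trans (le_abs_self _)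
  set κ : ℝ := 2 * L + CΔ + 1 with hκ_def
  refine ⟨fun j => Real.exp (κ * T) * ((∫ x, ‖us j 0 x - u 0 x‖ ^ 2) +
      (2 * (∫ s in (0 : ℝ)..T, Real.sqrt (∫ x, ‖fs j s x - f s x‖ ^ 2)) + νs j * CΔ * T)), ?_, ?_⟩
  · have h := (hdata.add ((hforce.const_mul 2).add ((hν₀.mul_const CΔ).mul_const T))).const_mul
      (Real.exp (κ * T))
    simpa using h
  · have h1 : ∀ᶠ j in atTop, νs j ≤ 1 := hν₀.eventually (eventually_le_nhds one_pos)
    have hM0 : Tendsto (fun j => Real.exp (κ * T) * ((∫ x, ‖us j 0 x - u 0 x‖ ^ 2) +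
        (2 * (∫ s in (0 : ℝ)..T, Real.sqrt (∫ x, ‖fs j s x - f s x‖ ^ 2)) + νs j * CΔ * T)))
        atTop (𝓝 0) := by
      have h := (hdata.add ((hforce.const_mul 2).add ((hν₀.mul_const CΔ).mul_const T))).const_mul
        (Real.exp (κ * T))
      simpa using h
    have h2 := hM0.eventually (eventually_lt_nhds one_pos)
    filter_upwards [h1, h2] with j hj1 hj2
    exact hE.integral_norm_sub_sq_le_of_lt_one hT (hN j) (hν j) hj1 hL0 hL hCΔ hj2

end Gronwall

/-! ## Passing to the limit in the energy balance -/

section Energy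

omit [DecidableEq d] in
/-- `∫ ‖a‖² ≤ 2 ∫ ‖a − b‖² + 2 ∫ ‖b‖²` for continuous fields on the torus. [folklore] -/
theorem integral_norm_sq_le_two_mul {a b : UnitAddTorus d → EuclideanSpace ℝ d} (ha : Continuous a)
    (hb : Continuous b) :
    ∫ x, ‖a x‖ ^ 2 ≤ 2 * (∫ x, ‖a x - b x‖ ^ 2) + 2 * ∫ x, ‖b x‖ ^ 2 := by
  have i0 : Integrable (fun x => ‖a x‖ ^ 2) volume := (ha.norm.pow 2).integrable_unitAddTorus
  have i1 : Integrable (fun x => ‖a x - b x‖ ^ 2) volume :=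
    ((ha.sub hb).norm.pow 2).integrable_unitAddTorus
  have i2 : Integrable (fun x => ‖b x‖ ^ 2) volume := (hb.norm.pow 2).integrable_unitAddTorus
  have i12 : Integrable (fun x => 2 * ‖a x - b x‖ ^ 2 + 2 * ‖b x‖ ^ 2) volume :=
    (i1.const_mul 2).add (i2.const_mul 2)
  calc ∫ x, ‖a x‖ ^ 2 ≤ ∫ x, (2 * ‖a x - b x‖ ^ 2 + 2 * ‖b x‖ ^ 2) := by
        refine integral_mono i0 i12 fun x => ?_
        show ‖a x‖ ^ 2 ≤ 2 * ‖a x - b x‖ ^ 2 + 2 * ‖b x‖ ^ 2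
        have h1 : ‖a x‖ ≤ ‖a x - b x‖ + ‖b x‖ := by
          calc ‖a x‖ = ‖(a x - b x) + b x‖ := by rw [sub_add_cancel]
            _ ≤ ‖a x - b x‖ + ‖b x‖ := norm_add_le _ _
        nlinarith [norm_nonneg (a x - b x), norm_nonneg (b x), norm_nonneg (a x),
          sq_nonneg (‖a x - b x‖ - ‖b x‖)]
    _ = 2 * (∫ x, ‖a x - b x‖ ^ 2) + 2 * ∫ x, ‖b x‖ ^ 2 := by
        have i1' : Integrable (fun x => 2 * ‖a x - b x‖ ^ 2) volume := i1.const_mul 2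
        have i2' : Integrable (fun x => 2 * ‖b x‖ ^ 2) volume := i2.const_mul 2
        rw [integral_add i1' i2', integral_const_mul, integral_const_mul]

omit [DecidableEq d] in
/-- The kinetic energy is continuous in `L²`, quantitatively:
`|E(a) − E(b)| ≤ ½ (‖a − b‖²_{L²} + 2 ‖a − b‖_{L²} ‖b‖_{L²})` (`‖a‖² = ‖a−b‖² + 2⟪a−b, b⟫ + ‖b‖²`
and Cauchy–Schwarz). [folklore] -/
theorem abs_kineticEnergy_sub_le {a b : UnitAddTorus d → EuclideanSpace ℝ d} (ha : Continuous a)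
    (hb : Continuous b) :
    |Literature.Analysis.FunctionSpaces.Torus.kineticEnergy a - Literature.Analysis.FunctionSpaces.Torus.kineticEnergy b| ≤
      2⁻¹ * ((∫ x, ‖a x - b x‖ ^ 2) +
        2 * (Real.sqrt (∫ x, ‖a x - b x‖ ^ 2) * Real.sqrt (∫ x, ‖b x‖ ^ 2))) := by
  have hid : ∀ x, ‖a x‖ ^ 2 = ‖a x - b x‖ ^ 2 + 2 * ⟪a x - b x, b x⟫_ℝ + ‖b x‖ ^ 2 := by
    intro x
    have h := norm_add_sq_real (a x - b x) (b x)
    rwa [sub_add_cancel] at h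
  have i1 : Integrable (fun x => ‖a x - b x‖ ^ 2) volume :=
    ((ha.sub hb).norm.pow 2).integrable_unitAddTorus
  have i2 : Integrable (fun x => 2 * ⟪a x - b x, b x⟫_ℝ) volume :=
    (continuous_const.mul ((ha.sub hb).inner hb)).integrable_unitAddTorus
  have i12 : Integrable (fun x => ‖a x - b x‖ ^ 2 + 2 * ⟪a x - b x, b x⟫_ℝ) volume := i1.add i2
  have i3 : Integrable (fun x => ‖b x‖ ^ 2) volume := (hb.norm.pow 2).integrable_unitAddTorus
  have hE : Literature.Analysis.FunctionSpaces.Torus.kineticEnergy a - Literature.Analysis.FunctionSpaces.Torus.kineticEnergy b =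
      2⁻¹ * ((∫ x, ‖a x - b x‖ ^ 2) + 2 * ∫ x, ⟪a x - b x, b x⟫_ℝ) := by
    simp only [Literature.Analysis.FunctionSpaces.Torus.kineticEnergy]
    rw [integral_congr_ae (ae_of_all _ hid), integral_add i12 i3, integral_add i1 i2,
      integral_const_mul]
    ring
  have hy0 : 0 ≤ ∫ x, ‖a x - b x‖ ^ 2 := integral_nonneg fun x => sq_nonneg _
  rw [hE, abs_mul, abs_of_pos (by norm_num : (0 : ℝ) < 2⁻¹)]
  refine mul_le_mul_of_nonneg_left ?_ (by norm_num)
  calc |(∫ x, ‖a x - b x‖ ^ 2) + 2 * ∫ x, ⟪a x - b x, b x⟫_ℝ|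
      ≤ |∫ x, ‖a x - b x‖ ^ 2| + |2 * ∫ x, ⟪a x - b x, b x⟫_ℝ| := abs_add_le _ _
    _ = (∫ x, ‖a x - b x‖ ^ 2) + 2 * |∫ x, ⟪a x - b x, b x⟫_ℝ| := by
        rw [abs_of_nonneg hy0, abs_mul, abs_two]
    _ ≤ (∫ x, ‖a x - b x‖ ^ 2) +
        2 * (Real.sqrt (∫ x, ‖a x - b x‖ ^ 2) * Real.sqrt (∫ x, ‖b x‖ ^ 2)) := by
        gcongr
        exact abs_integral_inner_le_sqrt_mul_sqrt (ha.sub hb) hb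

omit [DecidableEq d] in
/-- Continuity of the work term in `L²`:
`|∫ ⟪Fν, aν⟫ − ∫ ⟪F, a⟫| ≤ ‖Fν − F‖_{L²} ‖aν‖_{L²} + ‖F‖_{L²} ‖aν − a‖_{L²}`. [folklore] -/
theorem abs_integral_inner_sub_integral_inner_le {F Fν a aν : UnitAddTorus d → EuclideanSpace ℝ d}
    (hF : Continuous F) (hFν : Continuous Fν) (ha : Continuous a) (haν : Continuous aν) :
    |(∫ x, ⟪Fν x, aν x⟫_ℝ) - ∫ x, ⟪F x, a x⟫_ℝ| ≤
      Real.sqrt (∫ x, ‖Fν x - F x‖ ^ 2) * Real.sqrt (∫ x, ‖aν x‖ ^ 2) +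
        Real.sqrt (∫ x, ‖F x‖ ^ 2) * Real.sqrt (∫ x, ‖aν x - a x‖ ^ 2) := by
  have hid : ∀ x, ⟪Fν x, aν x⟫_ℝ - ⟪F x, a x⟫_ℝ = ⟪Fν x - F x, aν x⟫_ℝ + ⟪F x, aν x - a x⟫_ℝ := by
    intro x
    rw [inner_sub_left, inner_sub_right]
    ring
  have i1 : Integrable (fun x => ⟪Fν x, aν x⟫_ℝ) volume := (hFν.inner haν).integrable_unitAddTorus
  have i2 : Integrable (fun x => ⟪F x, a x⟫_ℝ) volume := (hF.inner ha).integrable_unitAddTorus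
  have i3 : Integrable (fun x => ⟪Fν x - F x, aν x⟫_ℝ) volume :=
    ((hFν.sub hF).inner haν).integrable_unitAddTorus
  have i4 : Integrable (fun x => ⟪F x, aν x - a x⟫_ℝ) volume :=
    (hF.inner (haν.sub ha)).integrable_unitAddTorus
  rw [← integral_sub i1 i2, integral_congr_ae (ae_of_all _ hid), integral_add i3 i4]
  calc |(∫ x, ⟪Fν x - F x, aν x⟫_ℝ) + ∫ x, ⟪F x, aν x - a x⟫_ℝ|
      ≤ |∫ x, ⟪Fν x - F x, aν x⟫_ℝ| + |∫ x, ⟪F x, aν x - a x⟫_ℝ| := abs_add_le _ _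
    _ ≤ _ := add_le_add (abs_integral_inner_le_sqrt_mul_sqrt (hFν.sub hF) haν)
        (abs_integral_inner_le_sqrt_mul_sqrt hF (haν.sub ha))

variable {f u : ℝ → UnitAddTorus d → EuclideanSpace ℝ d} {p : ℝ → UnitAddTorus d → ℝ}

/-- **No anomalous dissipation before the first Euler singularity, real form (Bruè–De Lellis
2023, §1 with the Appendix).** For a classical forced Euler solution `(u, p, f)` on
`[0, T] × T^d` and classical Navier–Stokes solutions `(u_j, p_j, f_j)` with viscosities
`ν_j ↓ 0`, forces `∫₀ᵀ ‖f_j − f‖_{L²} → 0` and data `‖u_j(0) − u(0)‖²_{L²} → 0`, the energy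
dissipation `ν_j ∫₀ᵀ ‖∇u_j‖² dt` tends to `0`: by the energy equalities
`ν_j ∫₀ᵀ ‖∇u_j‖² = E(u_j(0)) − E(u_j(T)) + ∫₀ᵀ∫ ⟪f_j, u_j⟫` and
`0 = E(u(0)) − E(u(T)) + ∫₀ᵀ∫ ⟪f, u⟫` (`Torus.IsClassicalNSSolutionOn.energy_eq`), and the
uniform `L²` convergence `u_j → u` on `[0, T]`
(`exists_uniform_integral_norm_sub_sq_le`), every term on the right converges. [cite: BrueDeLellis2023, §1 and Appendix, Lemma 7 (arXiv numbering)] -/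
theorem _root_.Literature.Analysis.FunctionSpaces.Torus.IsClassicalNSSolutionOn.tendsto_cumulativeDissipation {T : ℝ} (hT : 0 < T)
    (hE : Literature.Analysis.FunctionSpaces.Torus.IsClassicalNSSolutionOn (Icc 0 T) 0 f u p) {νs : ℕ → ℝ} (hν : ∀ j, 0 < νs j)
    (hν₀ : Tendsto νs atTop (𝓝 0)) {fs us : ℕ → ℝ → UnitAddTorus d → EuclideanSpace ℝ d}
    {ps : ℕ → ℝ → UnitAddTorus d → ℝ}
    (hN : ∀ j, Literature.Analysis.FunctionSpaces.Torus.IsClassicalNSSolutionOn (Icc 0 T) (νs j) (fs j) (us j) (ps j))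
    (hforce : Tendsto (fun j => ∫ t in (0 : ℝ)..T, Real.sqrt (∫ x, ‖fs j t x - f t x‖ ^ 2))
      atTop (𝓝 0))
    (hdata : Tendsto (fun j => ∫ x, ‖us j 0 x - u 0 x‖ ^ 2) atTop (𝓝 0)) :
    Tendsto (fun j => Literature.Analysis.FunctionSpaces.Torus.cumulativeDissipation (νs j) (us j) 0 T) atTop (𝓝 0) := by
  set S : Set ℝ := Icc 0 T with hS_def
  have hSc : Convex ℝ S := convex_Icc 0 T
  have hU : UniqueDiffOn ℝ S := uniqueDiffOn_Icc hT
  have h0S : (0 : ℝ) ∈ S := ⟨le_rfl, hT.le⟩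
  have hTS : T ∈ S := ⟨hT.le, le_rfl⟩
  have hu := hE.smooth_velocity
  have hf : Literature.Analysis.FunctionSpaces.Torus.IsSmoothSpaceTimeOn S f := hE.force_isSmoothSpaceTimeOn_Icc hT
  obtain ⟨M, hM0, hbound⟩ :=
    hE.exists_uniform_integral_norm_sub_sq_le hT hν hν₀ hN hforce hdata
  have hM1 : ∀ᶠ j in atTop, M j ≤ 1 := hM0.eventually (eventually_le_nhds one_pos)
  -- uniform bounds on `u` and `f`
  obtain ⟨Cu, hCu⟩ := hu.exists_norm_le_of_isCompact isCompact_Icc subset_rfl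
  obtain ⟨Cf, hCf⟩ := hf.exists_norm_le_of_isCompact isCompact_Icc subset_rfl
  have hsq : ∀ {v : UnitAddTorus d → EuclideanSpace ℝ d} {C : ℝ}, Continuous v →
      (∀ x, ‖v x‖ ≤ C) → ∫ x, ‖v x‖ ^ 2 ≤ C ^ 2 := by
    intro v C hv hC
    calc ∫ x, ‖v x‖ ^ 2 ≤ ∫ _x : UnitAddTorus d, C ^ 2 := by
          refine integral_mono (hv.norm.pow 2).integrable_unitAddTorus (integrable_const _)
            fun x => ?_
          show ‖v x‖ ^ 2 ≤ C ^ 2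
          nlinarith [norm_nonneg (v x), hC x]
      _ = C ^ 2 := by simp
  have hIu : ∀ t ∈ S, ∫ x, ‖u t x‖ ^ 2 ≤ Cu ^ 2 := fun t ht =>
    hsq (hu.isSmooth_slice ht).continuous (hCu t ht)
  have hIf : ∀ t ∈ S, ∫ x, ‖f t x‖ ^ 2 ≤ Cf ^ 2 := fun t ht =>
    hsq (hf.isSmooth_slice ht).continuous (hCf t ht)
  -- (1) the kinetic energies converge at every `t₀ ∈ [0, T]`
  have hEn : ∀ t₀ ∈ S,
      Tendsto (fun j => Literature.Analysis.FunctionSpaces.Torus.kineticEnergy (us j t₀) - Literature.Analysis.FunctionSpaces.Torus.kineticEnergy (u t₀)) atTop (𝓝 0) := by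
    intro t₀ ht₀
    have hlim : Tendsto (fun j => 2⁻¹ * (M j +
        2 * (Real.sqrt (M j) * Real.sqrt (∫ x, ‖u t₀ x‖ ^ 2)))) atTop (𝓝 0) := by
      have h := (hM0.add ((hM0.sqrt.mul_const (Real.sqrt (∫ x, ‖u t₀ x‖ ^ 2))).const_mul
        2)).const_mul (2⁻¹ : ℝ)
      simpa using h
    refine squeeze_zero_norm' ?_ hlim
    filter_upwards [hbound] with j hj
    have hjt : ∫ x, ‖us j t₀ x - u t₀ x‖ ^ 2 ≤ M j := hj t₀ ht₀
    rw [Real.norm_eq_abs]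
    calc |Literature.Analysis.FunctionSpaces.Torus.kineticEnergy (us j t₀) - Literature.Analysis.FunctionSpaces.Torus.kineticEnergy (u t₀)|
        ≤ 2⁻¹ * ((∫ x, ‖us j t₀ x - u t₀ x‖ ^ 2) +
            2 * (Real.sqrt (∫ x, ‖us j t₀ x - u t₀ x‖ ^ 2) *
              Real.sqrt (∫ x, ‖u t₀ x‖ ^ 2))) :=
          abs_kineticEnergy_sub_le ((hN j).smooth_velocity.isSmooth_slice ht₀).continuous
            (hu.isSmooth_slice ht₀).continuous
      _ ≤ 2⁻¹ * (M j + 2 * (Real.sqrt (M j) * Real.sqrt (∫ x, ‖u t₀ x‖ ^ 2))) := by gcongr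
  -- (2) the work of the forces converges
  have hP : Tendsto (fun j => (∫ τ in (0 : ℝ)..T, ∫ x, ⟪fs j τ x, us j τ x⟫_ℝ) -
      ∫ τ in (0 : ℝ)..T, ∫ x, ⟪f τ x, u τ x⟫_ℝ) atTop (𝓝 0) := by
    set A : ℝ := Real.sqrt (2 * 1 + 2 * Cu ^ 2) with hA_def
    have hlim : Tendsto (fun j => A * (∫ t in (0 : ℝ)..T, Real.sqrt (∫ x, ‖fs j t x - f t x‖ ^ 2))
        + |Cf| * Real.sqrt (M j) * T) atTop (𝓝 0) := by
      have h := (hforce.const_mul A).add ((hM0.sqrt.const_mul |Cf|).mul_const T)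
      simpa using h
    refine squeeze_zero_norm' ?_ hlim
    filter_upwards [hbound, hM1] with j hj hj1
    have hfj : Literature.Analysis.FunctionSpaces.Torus.IsSmoothSpaceTimeOn S (fs j) := (hN j).force_isSmoothSpaceTimeOn_Icc hT
    have huj := (hN j).smooth_velocity
    have hPc : ContinuousOn (fun τ => ∫ x, ⟪fs j τ x, us j τ x⟫_ℝ) S :=
      (hfj.inner huj).continuousOn_integral hSc
    have hQc : ContinuousOn (fun τ => ∫ x, ⟪f τ x, u τ x⟫_ℝ) S :=
      (hf.inner hu).continuousOn_integral hSc
    have hgc : ContinuousOn (fun τ => Real.sqrt (∫ x, ‖fs j τ x - f τ x‖ ^ 2)) S :=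
      Real.continuous_sqrt.comp_continuousOn ((hfj.sub hf).normSq.continuousOn_integral hSc)
    have hPi : IntervalIntegrable (fun τ => ∫ x, ⟪fs j τ x, us j τ x⟫_ℝ) volume 0 T :=
      hPc.intervalIntegrable_of_Icc hT.le
    have hQi : IntervalIntegrable (fun τ => ∫ x, ⟪f τ x, u τ x⟫_ℝ) volume 0 T :=
      hQc.intervalIntegrable_of_Icc hT.le
    have hgi : IntervalIntegrable (fun τ => Real.sqrt (∫ x, ‖fs j τ x - f τ x‖ ^ 2)) volume 0 T :=
      hgc.intervalIntegrable_of_Icc hT.le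
    have hPQi : IntervalIntegrable
        (fun τ => ‖(∫ x, ⟪fs j τ x, us j τ x⟫_ℝ) - ∫ x, ⟪f τ x, u τ x⟫_ℝ‖) volume 0 T :=
      (hPi.sub hQi).norm
    have hBi : IntervalIntegrable
        (fun τ => A * Real.sqrt (∫ x, ‖fs j τ x - f τ x‖ ^ 2) + |Cf| * Real.sqrt (M j))
        volume 0 T := (hgi.const_mul A).add intervalIntegrable_const
    -- pointwise bound on `[0, T]`
    have hpt : ∀ τ ∈ Icc 0 T, ‖(∫ x, ⟪fs j τ x, us j τ x⟫_ℝ) - ∫ x, ⟪f τ x, u τ x⟫_ℝ‖ ≤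
        A * Real.sqrt (∫ x, ‖fs j τ x - f τ x‖ ^ 2) + |Cf| * Real.sqrt (M j) := by
      intro τ hτ
      have hujτ : Continuous (us j τ) := (huj.isSmooth_slice hτ).continuous
      have huτ : Continuous (u τ) := (hu.isSmooth_slice hτ).continuous
      have hfjτ : Continuous (fs j τ) := (hfj.isSmooth_slice hτ).continuous
      have hfτ : Continuous (f τ) := (hf.isSmooth_slice hτ).continuous
      have h1 := abs_integral_inner_sub_integral_inner_le hfτ hfjτ huτ hujτ
      have h2 : Real.sqrt (∫ x, ‖us j τ x‖ ^ 2) ≤ A := by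
        apply Real.sqrt_le_sqrt
        have h := integral_norm_sq_le_two_mul hujτ huτ
        have h' := hj τ hτ
        have h'' := hIu τ hτ
        nlinarith
      have h3 : Real.sqrt (∫ x, ‖f τ x‖ ^ 2) ≤ |Cf| := by
        rw [← Real.sqrt_sq_eq_abs]
        exact Real.sqrt_le_sqrt (hIf τ hτ)
      have h4 : Real.sqrt (∫ x, ‖us j τ x - u τ x‖ ^ 2) ≤ Real.sqrt (M j) :=
        Real.sqrt_le_sqrt (hj τ hτ)
      rw [Real.norm_eq_abs]
      calc |(∫ x, ⟪fs j τ x, us j τ x⟫_ℝ) - ∫ x, ⟪f τ x, u τ x⟫_ℝ|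
          ≤ Real.sqrt (∫ x, ‖fs j τ x - f τ x‖ ^ 2) * Real.sqrt (∫ x, ‖us j τ x‖ ^ 2) +
              Real.sqrt (∫ x, ‖f τ x‖ ^ 2) * Real.sqrt (∫ x, ‖us j τ x - u τ x‖ ^ 2) := h1
        _ ≤ Real.sqrt (∫ x, ‖fs j τ x - f τ x‖ ^ 2) * A + |Cf| * Real.sqrt (M j) := by
            gcongr
        _ = A * Real.sqrt (∫ x, ‖fs j τ x - f τ x‖ ^ 2) + |Cf| * Real.sqrt (M j) := by ring
    calc ‖(∫ τ in (0 : ℝ)..T, ∫ x, ⟪fs j τ x, us j τ x⟫_ℝ) - ∫ τ in (0 : ℝ)..T, ∫ x, ⟪f τ x, u τ x⟫_ℝ‖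
        = ‖∫ τ in (0 : ℝ)..T, ((∫ x, ⟪fs j τ x, us j τ x⟫_ℝ) - ∫ x, ⟪f τ x, u τ x⟫_ℝ)‖ := by
          rw [intervalIntegral.integral_sub hPi hQi]
      _ ≤ ∫ τ in (0 : ℝ)..T, ‖(∫ x, ⟪fs j τ x, us j τ x⟫_ℝ) - ∫ x, ⟪f τ x, u τ x⟫_ℝ‖ :=
          intervalIntegral.norm_integral_le_integral_norm hT.le
      _ ≤ ∫ τ in (0 : ℝ)..T,
            (A * Real.sqrt (∫ x, ‖fs j τ x - f τ x‖ ^ 2) + |Cf| * Real.sqrt (M j)) :=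
          intervalIntegral.integral_mono_on hT.le hPQi hBi hpt
      _ = A * (∫ t in (0 : ℝ)..T, Real.sqrt (∫ x, ‖fs j t x - f t x‖ ^ 2)) +
            |Cf| * Real.sqrt (M j) * T := by
          rw [intervalIntegral.integral_add (hgi.const_mul A) intervalIntegrable_const,
            intervalIntegral.integral_const_mul, intervalIntegral.integral_const, sub_zero,
            smul_eq_mul]
          ring
  -- (3) the energy identities
  have hEN : ∀ j, Literature.Analysis.FunctionSpaces.Torus.cumulativeDissipation (νs j) (us j) 0 T =
      (Literature.Analysis.FunctionSpaces.Torus.kineticEnergy (us j 0) - Literature.Analysis.FunctionSpaces.Torus.kineticEnergy (u 0)) - (Literature.Analysis.FunctionSpaces.Torus.kineticEnergy (us j T) - Literature.Analysis.FunctionSpaces.Torus.kineticEnergy (u T))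
        + ((∫ τ in (0 : ℝ)..T, ∫ x, ⟪fs j τ x, us j τ x⟫_ℝ) -
            ∫ τ in (0 : ℝ)..T, ∫ x, ⟪f τ x, u τ x⟫_ℝ) := by
    intro j
    have h1 := (hN j).energy_eq hSc hT.le subset_rfl
    have h2 := hE.energy_eq hSc hT.le subset_rfl
    rw [zero_mul, add_zero] at h2
    rw [Literature.Analysis.FunctionSpaces.Torus.cumulativeDissipation]
    linarith
  have h := ((hEn 0 h0S).sub (hEn T hTS)).add hP
  rw [sub_zero, add_zero] at h
  exact h.congr' (Eventually.of_forall fun j => (hEN j).symm)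

end Energy

/-! ## From Mathlib's `eLpNorm` to `∫ ‖·‖²` on smooth slices -/

section Conversion

omit [DecidableEq d] in
/-- `‖a − b‖_{L²} = √(∫ ‖a − b‖²)` for smooth fields on the torus. [folklore] -/
theorem toReal_eLpNorm_two_sub_eq_sqrt {a b : UnitAddTorus d → EuclideanSpace ℝ d}
    (ha : Literature.Analysis.FunctionSpaces.Torus.IsSmooth a) (hb : Literature.Analysis.FunctionSpaces.Torus.IsSmooth b) :
    (eLpNorm (a - b) 2 volume).toReal = Real.sqrt (∫ x, ‖a x - b x‖ ^ 2) :=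
  toReal_eLpNorm_two_eq_sqrt ((ha.sub hb).memLp 2)

omit [DecidableEq d] in
/-- `‖a_j − b‖_{L²} → 0` in `ℝ≥0∞` gives `∫ ‖a_j − b‖² → 0`, for smooth fields on the torus. [folklore] -/
theorem tendsto_integral_norm_sub_sq_of_tendsto_eLpNorm {a : ℕ → UnitAddTorus d → EuclideanSpace ℝ d}
    {b : UnitAddTorus d → EuclideanSpace ℝ d} (ha : ∀ j, Literature.Analysis.FunctionSpaces.Torus.IsSmooth (a j)) (hb : Literature.Analysis.FunctionSpaces.Torus.IsSmooth b)
    (h : Tendsto (fun j => eLpNorm (a j - b) 2 volume) atTop (𝓝 0)) :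
    Tendsto (fun j => ∫ x, ‖a j x - b x‖ ^ 2) atTop (𝓝 0) := by
  have h1 : Tendsto (fun j => (eLpNorm (a j - b) 2 volume).toReal) atTop (𝓝 0) := by
    have h' := (ENNReal.tendsto_toReal ENNReal.zero_ne_top).comp h
    rw [ENNReal.toReal_zero] at h'
    exact h'
  have h2 : Tendsto (fun j => (eLpNorm (a j - b) 2 volume).toReal ^ 2) atTop (𝓝 0) := by
    simpa using h1.pow 2
  refine h2.congr' (Eventually.of_forall fun j => ?_)
  have h0le : 0 ≤ ∫ x, ‖a j x - b x‖ ^ 2 := integral_nonneg fun x => sq_nonneg _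
  rw [toReal_eLpNorm_two_sub_eq_sqrt (ha j) hb, Real.sq_sqrt h0le]

variable {f u : ℝ → UnitAddTorus d → EuclideanSpace ℝ d} {p : ℝ → UnitAddTorus d → ℝ}

/-- For classical solutions on `[0, T]`, the `L¹(0,T; L²)` distance of the forces in the two
spellings `∫₀ᵀ ‖f' − f‖_{L²}` (Mathlib's `eLpNorm`) and `∫₀ᵀ √(∫ ‖f' − f‖²)` agree (the force
slices are smooth, `force_isSmoothSpaceTimeOn`). [folklore] -/
theorem _root_.Literature.Analysis.FunctionSpaces.Torus.IsClassicalNSSolutionOn.intervalIntegral_toReal_eLpNorm_force_sub {T ν ν' : ℝ} (hT : 0 < T)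
    {f' u' : ℝ → UnitAddTorus d → EuclideanSpace ℝ d} {p' : ℝ → UnitAddTorus d → ℝ}
    (h : Literature.Analysis.FunctionSpaces.Torus.IsClassicalNSSolutionOn (Icc 0 T) ν f u p) (h' : Literature.Analysis.FunctionSpaces.Torus.IsClassicalNSSolutionOn (Icc 0 T) ν' f' u' p') :
    ∫ t in (0 : ℝ)..T, (eLpNorm (f' t - f t) 2 volume).toReal =
      ∫ t in (0 : ℝ)..T, Real.sqrt (∫ x, ‖f' t x - f t x‖ ^ 2) := by
  have hU : UniqueDiffOn ℝ (Icc 0 T) := uniqueDiffOn_Icc hT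
  refine intervalIntegral.integral_congr fun t ht => ?_
  rw [uIcc_of_le hT.le] at ht
  exact toReal_eLpNorm_two_sub_eq_sqrt ((h'.force_isSmoothSpaceTimeOn_Icc hT).isSmooth_slice ht)
    ((h.force_isSmoothSpaceTimeOn_Icc hT).isSmooth_slice ht)

/-- **`C([0,T]; L²)` convergence in Mathlib's spelling.** Under the hypotheses of
`exists_uniform_integral_norm_sub_sq_le`, `sup_{t ∈ [0,T]} ‖u_j(t) − u(t)‖_{L²} → 0`
(as an `ℝ≥0∞`-valued supremum of `eLpNorm`s). [cite: BrueDeLellis2023, Appendix, Lemma 7 (arXiv numbering)] -/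
theorem _root_.Literature.Analysis.FunctionSpaces.Torus.IsClassicalNSSolutionOn.tendsto_iSup_eLpNorm_sub {T : ℝ} (hT : 0 < T)
    (hE : Literature.Analysis.FunctionSpaces.Torus.IsClassicalNSSolutionOn (Icc 0 T) 0 f u p) {νs : ℕ → ℝ} (hν : ∀ j, 0 < νs j)
    (hν₀ : Tendsto νs atTop (𝓝 0)) {fs us : ℕ → ℝ → UnitAddTorus d → EuclideanSpace ℝ d}
    {ps : ℕ → ℝ → UnitAddTorus d → ℝ}
    (hN : ∀ j, Literature.Analysis.FunctionSpaces.Torus.IsClassicalNSSolutionOn (Icc 0 T) (νs j) (fs j) (us j) (ps j))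
    (hforce : Tendsto (fun j => ∫ t in (0 : ℝ)..T, Real.sqrt (∫ x, ‖fs j t x - f t x‖ ^ 2))
      atTop (𝓝 0))
    (hdata : Tendsto (fun j => ∫ x, ‖us j 0 x - u 0 x‖ ^ 2) atTop (𝓝 0)) :
    Tendsto (fun j => ⨆ t ∈ Icc 0 T, eLpNorm (us j t - u t) 2 volume) atTop (𝓝 0) := by
  obtain ⟨M, hM0, hbound⟩ :=
    hE.exists_uniform_integral_norm_sub_sq_le hT hν hν₀ hN hforce hdata
  have hu := hE.smooth_velocity
  have hup : ∀ᶠ j in atTop,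
      (⨆ t ∈ Icc 0 T, eLpNorm (us j t - u t) 2 volume) ≤ ENNReal.ofReal (Real.sqrt (M j)) := by
    filter_upwards [hbound] with j hj
    refine iSup₂_le fun t ht => ?_
    have hus : Literature.Analysis.FunctionSpaces.Torus.IsSmooth (us j t) := (hN j).smooth_velocity.isSmooth_slice ht
    have hut : Literature.Analysis.FunctionSpaces.Torus.IsSmooth (u t) := hu.isSmooth_slice ht
    have hm : MemLp (us j t - u t) 2 volume := (hus.sub hut).memLp 2
    rw [← ENNReal.ofReal_toReal hm.eLpNorm_ne_top, toReal_eLpNorm_two_sub_eq_sqrt hus hut]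
    exact ENNReal.ofReal_le_ofReal (Real.sqrt_le_sqrt (hj t ht))
  have hlim : Tendsto (fun j => ENNReal.ofReal (Real.sqrt (M j))) atTop (𝓝 0) := by
    have h := ENNReal.tendsto_ofReal hM0.sqrt
    simpa using h
  exact tendsto_of_tendsto_of_tendsto_of_le_of_le' tendsto_const_nhds hlim
    (Eventually.of_forall fun j => bot_le) hup

end Conversion

end Torus

/-! ## The discharges -/

section Barriers
section AnomalousDissipation

/-- **Discharge of `BrueDeLellis2023_lemma7_convergence`** (Bruè–De Lellis, CMP 400 (2023) =
arXiv:2207.06301, Appendix (§9 of the arXiv version), Lemma 7 and the sentence following it: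
"if `ν ↓ 0`, `f^ν → f` in `L¹([0,T];L²)`, and `u^ν(·,0) → u(·,0)` in `L²`, then `u^ν → u` in
`C([0,T]; L²)`"). Proved as stated, via `Torus.IsClassicalNSSolutionOn.tendsto_iSup_eLpNorm_sub`
after rewriting Mathlib's `L²` norms of the smooth slices as square roots of `∫ ‖·‖²`.
[cite: BrueDeLellis2023, Appendix, Lemma 7 (arXiv numbering)] -/
theorem BrueDeLellis2023_lemma7_convergence_holds : BrueDeLellis2023_lemma7_convergence := by
  intro T hT f u p hE ν hν hν₀ fs us ps hNS hforce hdata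
  have h0 : (0 : ℝ) ∈ Icc 0 T := ⟨le_rfl, hT.le⟩
  refine Literature.Analysis.FunctionSpaces.Torus.IsClassicalNSSolutionOn.tendsto_iSup_eLpNorm_sub hT hE hν hν₀ hNS ?_ ?_
  · refine hforce.congr' (Eventually.of_forall fun j => ?_)
    exact hE.intervalIntegral_toReal_eLpNorm_force_sub hT (hNS j)
  · exact Torus.tendsto_integral_norm_sub_sq_of_tendsto_eLpNorm
      (fun j => (hNS j).smooth_velocity.isSmooth_slice h0) (hE.smooth_velocity.isSmooth_slice h0)
      hdata

/-- **Discharge of `BrueDeLellis2023_noAnomaly_beforeEulerSingularity`** (Bruè–De Lellis, CMP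
400 (2023) = arXiv:2207.06301, §1, p. 3: anomalous dissipation with uniformly smooth data and
forces "can only hold if `T` is larger than the first blow-up time of some suitable classical
solution of the incompressible Euler equations … From this strong convergence, it is then
elementary to infer that [anomalous dissipation] cannot hold", with the Appendix (§9 of the
arXiv version), Lemma 7 and the sentence following it). The vendored statement is proved as
stated (classical forced Euler solution on `[0, T]`, classical Navier–Stokes solutions with
`ν_j ↓ 0`, `f_j → f` in `L¹(0,T; L²)`, `u_j(0) → u(0)` in `L²`
⟹ `ν_j ∫₀ᵀ ‖∇u_j‖² → 0`): Mathlib's `L²` norms (`eLpNorm · 2 volume`) of the smooth slices are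
rewritten as square roots of `∫ ‖·‖²` and the real-variable form
`Torus.IsClassicalNSSolutionOn.tendsto_cumulativeDissipation` applies.
[cite: BrueDeLellis2023, §1 and Appendix, Lemma 7 (arXiv numbering)] -/
theorem BrueDeLellis2023_noAnomaly_beforeEulerSingularity_holds :
    BrueDeLellis2023_noAnomaly_beforeEulerSingularity := by
  intro T hT f u p hE ν hν hν₀ fs us ps hNS hforce hdata
  have h0 : (0 : ℝ) ∈ Icc 0 T := ⟨le_rfl, hT.le⟩
  refine Literature.Analysis.FunctionSpaces.Torus.IsClassicalNSSolutionOn.tendsto_cumulativeDissipation hT hE hν hν₀ hNS ?_ ?_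
  · refine hforce.congr' (Eventually.of_forall fun j => ?_)
    exact hE.intervalIntegral_toReal_eLpNorm_force_sub hT (hNS j)
  · exact Torus.tendsto_integral_norm_sub_sq_of_tendsto_eLpNorm
      (fun j => (hNS j).smooth_velocity.isSmooth_slice h0) (hE.smooth_velocity.isSmooth_slice h0)
      hdata

/-- **Discharge of `BrueDeLellis2023_noAnomaly_beforeEulerSingularityNarrow`** (the narrowed
companion recorded by the D-0021 barrier audit): classical solvability of smooth-forced Euler on
`T³` over `[0,1]` excludes a positive answer to the hub-form Question 2.1
(`Literature.Analysis.FluidPDE.BrueDeLellisQuestion21`, single force in `C^∞([0,1] × T³)`). One line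
from the discharged parent fact via `BrueDeLellis2023_noAnomaly_beforeEulerSingularity.narrow`.
[cite: BrueDeLellis2023, §1 and Appendix, Lemma 7 (arXiv numbering)] -/
theorem BrueDeLellis2023_noAnomaly_beforeEulerSingularityNarrow_holds :
    BrueDeLellis2023_noAnomaly_beforeEulerSingularityNarrow :=
  BrueDeLellis2023_noAnomaly_beforeEulerSingularity_holds.narrow

/-- **Hub-form Question 2.1 forces a breakdown of smooth-forced Euler on `T³` before `t = 1`**
(Bruè–De Lellis, CMP 400 (2023), §1: anomalous dissipation with uniformly smooth data and forces
"can only hold if `T` is larger than the first blow-up time of some suitable classical solution of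
the incompressible Euler equations"; here with the `ν`-independent `C^∞` force of the hub
formalisation, so that the "suitable classical solution" is the one with datum `u₀` and force `f`
themselves). Explicit form of `BrueDeLellis2023_noAnomaly_beforeEulerSingularityNarrow_holds`: a
positive answer to `Literature.Analysis.FluidPDE.BrueDeLellisQuestion21` yields a smooth
divergence-free `u₀` and a force `f ∈ C^∞([0,1] × T³)` such that **no** classical solution `(u,p)`
of forced Euler on `[0,1]` (the accepted `Torus.IsClassicalNSSolutionOn (Icc 0 1) 0 f u p`) has
`u(0) = u₀`. The printed Question 2.1 asks only for `f ∈ ⋂_{α<1} C^α`, to which this does not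
apply (see the `scope_caveats:` of the fact). [cite: BrueDeLellis2023, §1 and §2, Question 2.1] -/
theorem BrueDeLellis2023_question21_imp_forcedEuler_breakdown
    (hQ : Literature.Analysis.FluidPDE.BrueDeLellisQuestion21) :
    ∃ (u₀ : UnitAddTorus (Fin 3) → EuclideanSpace ℝ (Fin 3))
      (f : ℝ → UnitAddTorus (Fin 3) → EuclideanSpace ℝ (Fin 3)),
      Literature.Analysis.FunctionSpaces.Torus.IsSmooth u₀ ∧
      Literature.Analysis.FunctionSpaces.Torus.IsDivFree u₀ ∧
      Literature.Analysis.FunctionSpaces.Torus.IsSmoothSpaceTimeOn (Icc 0 1) f ∧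
      ∀ (u : ℝ → UnitAddTorus (Fin 3) → EuclideanSpace ℝ (Fin 3))
        (p : ℝ → UnitAddTorus (Fin 3) → ℝ),
        Literature.Analysis.FunctionSpaces.Torus.IsClassicalNSSolutionOn (Icc 0 1) 0 f u p → u 0 ≠ u₀ := by
  by_contra hcon
  refine BrueDeLellis2023_noAnomaly_beforeEulerSingularityNarrow_holds ?_ hQ
  intro u₀ f hu₀ hdiv hf
  by_contra hnone
  refine hcon ⟨u₀, f, hu₀, hdiv, hf, fun u p hE hu0 => hnone ⟨u, p, hE, hu0⟩⟩

/-- The same for the hub-form Question 2.2 (a single time-independent force `f ∈ C^∞(T³)`): a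
positive answer to `Literature.Analysis.FluidPDE.BrueDeLellisQuestion22` yields smooth `u₀`
(divergence free) and `f` such that no classical solution of Euler forced by `f` on `[0,1]` starts
from `u₀`. [cite: BrueDeLellis2023, §1 and §2, Question 2.2] -/
theorem BrueDeLellis2023_question22_imp_forcedEuler_breakdown
    (hQ : Literature.Analysis.FluidPDE.BrueDeLellisQuestion22) :
    ∃ (u₀ f : UnitAddTorus (Fin 3) → EuclideanSpace ℝ (Fin 3)),
      Literature.Analysis.FunctionSpaces.Torus.IsSmooth u₀ ∧
      Literature.Analysis.FunctionSpaces.Torus.IsDivFree u₀ ∧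
      Literature.Analysis.FunctionSpaces.Torus.IsSmooth f ∧
      ∀ (u : ℝ → UnitAddTorus (Fin 3) → EuclideanSpace ℝ (Fin 3))
        (p : ℝ → UnitAddTorus (Fin 3) → ℝ),
        Literature.Analysis.FunctionSpaces.Torus.IsClassicalNSSolutionOn (Icc 0 1) 0 (fun _ => f) u p →
          u 0 ≠ u₀ := by
  obtain ⟨ν, u₀, f, us, ps, hν, hu₀, hf, hsol, hAD⟩ := hQ
  have h0 : (0 : ℝ) ∈ Icc (0 : ℝ) 1 := ⟨le_rfl, zero_le_one⟩
  have hdiv : Literature.Analysis.FunctionSpaces.Torus.IsDivFree u₀ := by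
    rw [← (hsol 0).2]
    exact (hsol 0).1.divFree 0 h0
  refine ⟨u₀, f, hu₀, hdiv, hf, fun u p hE hu0 => ?_⟩
  have hforce : Tendsto (fun _ : ℕ => ∫ t in (0 : ℝ)..1,
      (eLpNorm ((fun _ : ℝ => f) t - (fun _ : ℝ => f) t) 2 volume).toReal) atTop (𝓝 0) := by
    have hz : (fun _ : ℕ => ∫ t in (0 : ℝ)..1,
        (eLpNorm ((fun _ : ℝ => f) t - (fun _ : ℝ => f) t) 2 volume).toReal) = fun _ => 0 := by
      funext j
      simp
    rw [hz]
    exact tendsto_const_nhds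
  have hdata : Tendsto (fun j => eLpNorm (us j 0 - u 0) 2 volume) atTop (𝓝 0) := by
    have hz : (fun j => eLpNorm (us j 0 - u 0) 2 volume) = fun _ => 0 := by
      funext j
      rw [(hsol j).2, hu0, sub_self]
      exact eLpNorm_zero
    rw [hz]
    exact tendsto_const_nhds
  exact Literature.Analysis.FluidPDE.not_hasAnomalousDissipation_of_tendsto_zero
    (BrueDeLellis2023_noAnomaly_beforeEulerSingularity_holds 1 one_pos (fun _ => f) u p hE ν
      (fun j => hν.2.2 j) hν.2.1 (fun _ _ => f) us ps (fun j => (hsol j).1) hforce hdata) hAD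

end AnomalousDissipation
end Barriers

end Literature.Barriers.AnomalousDissipation
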